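import Literature.NumberTheory.Sieve.HeathBrownCubicLemma92Cube
import Literature.NumberTheory.Sieve.HeathBrownCubicLemma81Holds
import HarnessLib

/-!
# Lemma 9.2 from Lemma 9.4, and Lemma 3.8 from Lemma 9.4

Final file of this seat's reduction of the named fact `HeathBrown2001_lemma_3_8` (Heath-Brown's Lemma 3.8, the
Siegel–Walfisz theorem for the Type II weights `f_S` in cubes) to the prime number theorem with Grössencharaktere for
`K = ℚ(2^{1/3})`: D. R. Heath-Brown, *Primes represented by `x³ + 2y³`*, Acta Math. 186 (2001), Lemma 9.2 (p. 52) and its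
proof on pp. 52–60, with Lemma 9.4 (p. 55, T. Mitsui, *Generalized prime number theorem*, Jap. J. Math. 26 (1956) 1–42) as
the only remaining input. The tree already proves Lemma 3.8 from Lemma 9.2 (`HeathBrown2001_lemma_3_8_of_lemma92`,
`HeathBrownCubicLemma81Holds`: Lemma 8.1, Lemma 9.1 and the Möbius bookkeeping of p. 52); this file proves Lemma 9.2 — in
exactly the form of that hypothesis — from `∀ A > 0, ∃ c > 0, C, z₀, GrossenCharPNT A c C z₀` (the log-weighted form of
Lemma 9.4 defined in `HeathBrownCubicGrossenPrimeSums`), and concludes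

* **`HeathBrown2001_lemma_9_2_of_lemma94`** — Lemma 9.2 from Lemma 9.4;
* **`HeathBrown2001_lemma_3_8_of_lemma94`** — `HeathBrown2001_lemma_3_8` from Lemma 9.4.

The proof follows pp. 52–60: the cube-level explicit statement `abs_cubeClassSum_sub_swMainTerm_le_bound` of
`HeathBrownCubicLemma92Cube` ((9.1), Lemma 9.3 via (9.2)–(9.10), Lemma 9.5, (9.15)–(9.22)) is specialised to
`τ = (log log X)^{−ϖ}`, `ξ = τ⁵`, `L = X^{τ/2}`, `ℓ = log L`, with the choices `Δ = exp{−c_Δ√ℓ}`,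
`c_Δ = min(c₉, c₂)/20` (`c₉` the constant of Lemma 9.4 for the exponent `A`, `c₂` that of Lemma 4.10), `K = ⌊exp{c₉√ℓ}⌋`
Fourier modes, `A₀ = X^τ/2`, and the verification, for `X ≥ X₀(ϖ, A, c₃, c₄)`, of the side conditions and of
`lemma92Bound ≤ C·V·exp{−c_Δ√ℓ}`:

* `bG_le`, `bErr8_div_le`, `bB1_le`, `bB2_le`, `bErr_term_le`, `lemma92Bound_le` — the explicit error pieces against `V·E`;
* `eventually_lemma92_params` — the facts on `τ`, `ξ log X`, `τ⁶ log X`, `√ℓ`, `1/τ ≤ e^{c√ℓ}`, `log log X ≤ ℓ/4` for large `X`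
  (all from `C(log log X)^s ≤ log X`, `eventually_mul_loglog_rpow_le`);
* `theta_bound_of_grossenCharPNT` (the range `u ≥ A₀ ≥ z₀`, `q ≤ ℓ^A ≤ (log u)^A`, `|j|, |k| < K ≤ e^{c₉√(log u)}`),
  `pow_three_lt_exp` (`q³ < X^τ`), `logX_div_sqrt_le`, `one_add_delta_pow_le_three`, `one_add_c1_pow_le_three`, `eps_bounds`,
  and small numerics (`exp_four_gt`, `log_le_two_mul_sqrt`, `one_add_pow_le_three`; `√2 < 3/2` is Mathlib's
  `Real.sqrt_two_lt_three_halves`).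

The case `k = 0` of the hypothesis (empty `𝐦`) is vacuous by (3.6) (`(1 + τ)ξ⁻¹ ≤ ∑ m_i`).

## References

* D. R. Heath-Brown, *Primes represented by `x³ + 2y³`*, Acta Math. 186 (2001), 1–84: Lemma 3.8 (p. 18), Lemma 9.2 (p. 52),
  Lemmas 9.3–9.5 and pp. 52–60. [cite: HeathBrownActa2001, Lemma 9.2; Lemma 3.8]
* T. Mitsui, *Generalized prime number theorem*, Jap. J. Math. 26 (1956), 1–42 (Lemma 9.4 of the paper). [cite: Mitsui1956, Lemma 9.4 of HeathBrownActa2001]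

## Mathlib / tree search

Tree: `abs_cubeClassSum_sub_swMainTerm_le_bound`, `lemma92Bound` and its pieces (`HeathBrownCubicLemma92Cube`),
`HeathBrown2001_lemma_3_8_of_lemma92` (`HeathBrownCubicLemma81Holds`), `GrossenCharPNT` (`HeathBrownCubicGrossenPrimeSums`),
`exists_lemma95Bound`, `exists_tupleCountBound`, `abs_degreeOneTheta_sub_self_le` (`DegreeOnePrimesPNT`), `corner_bounds`
(`HeathBrownCubicLemma92Chi`), `eventually_mul_loglog_rpow_le`, `hbTau`, `hbL`, `hbXi`, `card_mul_lt_of_coreAdmissible`,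
`one_le_prod_of_coreAdmissible`. `lean search 'lemma_9_2|lemma94|GrossenCharPNT' --decl`: only this seat's declarations.
-/

noncomputable section

open Polynomial NumberField Finset Complex MeasureTheory Filter Topology

namespace Literature.NumberTheory.Sieve.CubicSieve

open LFunctions.CubeRootTwoField LFunctions.NumberField CubicPrimes Literature.Analysis.Fourier

/-! ### Bounding the explicit error pieces by `V e^{−c√(log L)}` -/

section Pieces

variable {X τ : ℝ} {n : ℕ} {m : Fin (n + 1) → ℕ}

/-- **`G ≤ κ_G·ΔV`**: with `s = c₃V^{1/3} ≥ 1`, `S₀ ≤ 4s`, `0 < Δ ≤ 1` and `s² ≤ 4c₃³VΔ` (i.e. `sΔ ≥ 1/4`):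
`bG ≤ (16π(5 + 3κ₁)³ + 64(5 + 2κ₂)²(2κ₂ + 4))c₃³·ΔV`, `κ₁ = 2C₀(1 + c₄⁻¹)`, `κ₂ = C₀(1 + 2/c₄)(5 + 2κ₁)`. [folklore] -/
theorem bG_le {c₃ c₄ C₀ Δ V S₀ : ℝ} (hc₃ : 0 < c₃) (hc₄ : 0 < c₄) (hC₀ : 0 ≤ C₀) (hV : 0 < V) (hΔ : 0 < Δ) (hΔ1 : Δ ≤ 1)
    (hS₀0 : 0 ≤ S₀) (hs1 : 1 ≤ c₃ * V ^ (1 / 3 : ℝ)) (hS₀ : S₀ ≤ 4 * (c₃ * V ^ (1 / 3 : ℝ)))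
    (hsΔ : (c₃ * V ^ (1 / 3 : ℝ)) ^ 2 ≤ 4 * c₃ ^ 3 * V * Δ) :
    bG c₃ c₄ C₀ Δ V S₀ ≤
      (16 * Real.pi * (5 + 3 * (2 * C₀ * (1 + 1 / c₄))) ^ 3 +
        64 * (5 + 2 * (C₀ * (1 + 2 / c₄) * (5 + 2 * (2 * C₀ * (1 + 1 / c₄))))) ^ 2 *
          (2 * (C₀ * (1 + 2 / c₄) * (5 + 2 * (2 * C₀ * (1 + 1 / c₄)))) + 4)) * c₃ ^ 3 * (Δ * V) := by
  set s := c₃ * V ^ (1 / 3 : ℝ) with hs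
  have hs0 : 0 < s := by positivity
  have hs3 : s ^ 3 = c₃ ^ 3 * V := by
    rw [hs, mul_pow, ← Real.rpow_natCast (V ^ (1 / 3 : ℝ)) 3, ← Real.rpow_mul hV.le]; norm_num
  set κ₁ := 2 * C₀ * (1 + 1 / c₄) with hκ₁
  set κ₂ := C₀ * (1 + 2 / c₄) * (5 + 2 * κ₁) with hκ₂
  have hκ₁0 : 0 ≤ κ₁ := by positivity
  have hκ₂0 : 0 ≤ κ₂ := by positivity
  have hr : bSmallR c₃ c₄ C₀ Δ V = κ₁ * Δ * s := by rw [bSmallR, hκ₁, hs]; ring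
  have hrle : bSmallR c₃ c₄ C₀ Δ V ≤ κ₁ * s := by
    rw [hr]; calc κ₁ * Δ * s ≤ κ₁ * 1 * s := by gcongr
      _ = κ₁ * s := by ring
  have hr0 : 0 ≤ bSmallR c₃ c₄ C₀ Δ V := by rw [hr]; positivity
  have hρeq : bRho c₃ c₄ C₀ Δ V = C₀ * (1 + 2 / c₄) * Δ * (5 * s + 2 * bSmallR c₃ c₄ C₀ Δ V) := by
    rw [bRho, hs]; congr 1; field_simp
  have hρle : bRho c₃ c₄ C₀ Δ V ≤ κ₂ * Δ * s := by
    rw [hρeq, hκ₂]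
    have : 5 * s + 2 * bSmallR c₃ c₄ C₀ Δ V ≤ (5 + 2 * κ₁) * s := by nlinarith
    calc C₀ * (1 + 2 / c₄) * Δ * (5 * s + 2 * bSmallR c₃ c₄ C₀ Δ V) ≤ C₀ * (1 + 2 / c₄) * Δ * ((5 + 2 * κ₁) * s) :=
          mul_le_mul_of_nonneg_left this (by positivity)
      _ = C₀ * (1 + 2 / c₄) * (5 + 2 * κ₁) * Δ * s := by ring
  have hρ0 : 0 ≤ bRho c₃ c₄ C₀ Δ V := by rw [hρeq]; positivity
  have hρle' : bRho c₃ c₄ C₀ Δ V ≤ κ₂ * s := by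
    calc bRho c₃ c₄ C₀ Δ V ≤ κ₂ * Δ * s := hρle
      _ ≤ κ₂ * 1 * s := by gcongr
      _ = κ₂ * s := by ring
  -- first part
  have h1 : S₀ + 3 * bSmallR c₃ c₄ C₀ Δ V + 1 ≤ (5 + 3 * κ₁) * s := by nlinarith
  have h1' : (S₀ + 3 * bSmallR c₃ c₄ C₀ Δ V + 1) ^ 3 ≤ (5 + 3 * κ₁) ^ 3 * (c₃ ^ 3 * V) := by
    rw [← hs3, ← mul_pow]; exact pow_le_pow_left₀ (by positivity) h1 3
  -- second part
  have h2 : S₀ + 2 * bRho c₃ c₄ C₀ Δ V + 1 ≤ (5 + 2 * κ₂) * s := by nlinarith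
  have h2' : (S₀ + 2 * bRho c₃ c₄ C₀ Δ V + 1) ^ 2 ≤ (5 + 2 * κ₂) ^ 2 * s ^ 2 := by
    rw [← mul_pow]; exact pow_le_pow_left₀ (by positivity) h2 2
  have h3 : 2 * bRho c₃ c₄ C₀ Δ V + 1 ≤ 2 * κ₂ * Δ * s + 1 := by linarith
  have h4 : s ^ 2 * (2 * κ₂ * Δ * s + 1) ≤ (2 * κ₂ + 4) * (c₃ ^ 3 * V) * Δ := by
    have : s ^ 2 * (2 * κ₂ * Δ * s + 1) = 2 * κ₂ * Δ * s ^ 3 + s ^ 2 := by ring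
    rw [this, hs3]; nlinarith
  have h5 : (S₀ + 2 * bRho c₃ c₄ C₀ Δ V + 1) ^ 2 * (2 * bRho c₃ c₄ C₀ Δ V + 1) ≤ (5 + 2 * κ₂) ^ 2 * ((2 * κ₂ + 4) * (c₃ ^ 3 * V) * Δ) := by
    calc (S₀ + 2 * bRho c₃ c₄ C₀ Δ V + 1) ^ 2 * (2 * bRho c₃ c₄ C₀ Δ V + 1)
        ≤ (5 + 2 * κ₂) ^ 2 * s ^ 2 * (2 * κ₂ * Δ * s + 1) :=
          mul_le_mul h2' h3 (by positivity) (by positivity)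
      _ = (5 + 2 * κ₂) ^ 2 * (s ^ 2 * (2 * κ₂ * Δ * s + 1)) := by ring
      _ ≤ (5 + 2 * κ₂) ^ 2 * ((2 * κ₂ + 4) * (c₃ ^ 3 * V) * Δ) := mul_le_mul_of_nonneg_left h4 (by positivity)
  rw [bG]
  have hπ := Real.pi_pos
  calc 16 * Real.pi * Δ * (S₀ + 3 * bSmallR c₃ c₄ C₀ Δ V + 1) ^ 3 +
        64 * ((S₀ + 2 * bRho c₃ c₄ C₀ Δ V + 1) ^ 2 * (2 * bRho c₃ c₄ C₀ Δ V + 1))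
      ≤ 16 * Real.pi * Δ * ((5 + 3 * κ₁) ^ 3 * (c₃ ^ 3 * V)) + 64 * ((5 + 2 * κ₂) ^ 2 * ((2 * κ₂ + 4) * (c₃ ^ 3 * V) * Δ)) := by
        gcongr
    _ = (16 * Real.pi * (5 + 3 * κ₁) ^ 3 + 64 * (5 + 2 * κ₂) ^ 2 * (2 * κ₂ + 4)) * c₃ ^ 3 * (Δ * V) := by ring

/-- **`err₈/(γ₀ΔV·M₀) ≤ (704c₃³/(c₄γ₀))·ΔV`** (`M ≥ 1`, `ξ log X ≥ 1`, `S₀ ≤ 4c₃V^{1/3}`). [folklore] -/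
theorem bErr8_div_le (hX : 1 < X) (hξ1 : 1 ≤ hbXi τ * Real.log X) {M : ℝ} (hM : 1 ≤ M)
    {c₃ c₄ V Δ S₀ : ℝ} (hc₃ : 0 < c₃) (hc₄ : 0 < c₄) (hV : 0 < V) (hΔ : 0 < Δ) (hS₀0 : 0 ≤ S₀)
    (hS₀ : S₀ ≤ 4 * (c₃ * V ^ (1 / 3 : ℝ))) :
    bErr8 X τ (n := n) c₃ c₄ V Δ S₀ / (gamma₀ * Δ * V * (M * (hbXi τ * Real.log X) ^ (n + 1))) ≤
      704 * c₃ ^ 3 / (c₄ * gamma₀) * (Δ * V) := by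
  have hγ := gamma₀_pos
  have hlogX := Real.log_pos hX
  set s := c₃ * V ^ (1 / 3 : ℝ) with hs
  have hs0 : 0 < s := by positivity
  have hs3 : s ^ 3 = c₃ ^ 3 * V := by
    rw [hs, mul_pow, ← Real.rpow_natCast (V ^ (1 / 3 : ℝ)) 3, ← Real.rpow_mul hV.le]; norm_num
  set E := hbXi τ * Real.log X with hE
  have hE1 : 1 ≤ E := hξ1
  have hE0 : 0 < E := by linarith
  have hME : 1 ≤ M * E ^ (n + 1) := one_le_mul_of_one_le_of_one_le hM (one_le_pow₀ hE1)
  have hden : 0 < gamma₀ * Δ * V * (M * E ^ (n + 1)) := by positivity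
  rw [div_le_iff₀ hden, bErr8, ← hE]
  have hS2 : S₀ ^ 2 ≤ 16 * s ^ 2 := by nlinarith
  have hS3 : S₀ ^ 3 ≤ 64 * s ^ 3 := by
    calc S₀ ^ 3 ≤ (4 * s) ^ 3 := pow_le_pow_left₀ hS₀0 hS₀ 3
      _ = 64 * s ^ 3 := by ring
  have hEpow : E ^ (n - 1) ≤ E ^ (n + 1) := pow_le_pow_right₀ hE1 (by omega)
  have hlhs : Δ * V * (2 * (18 * (Δ * V) * S₀ ^ 2 * s / (c₄ * V))) + 2 * Δ ^ 2 * V / c₄ * E ^ (n - 1) * S₀ ^ 3 =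
      (36 * Δ ^ 2 * V * S₀ ^ 2 * s + 2 * Δ ^ 2 * V * E ^ (n - 1) * S₀ ^ 3) / c₄ := by
    field_simp
    ring
  have hrhs : 704 * c₃ ^ 3 / (c₄ * gamma₀) * (Δ * V) * (gamma₀ * Δ * V * (M * E ^ (n + 1))) =
      (704 * Δ ^ 2 * V * s ^ 3 * (M * E ^ (n + 1))) / c₄ := by
    rw [hs3]; field_simp
  rw [hlhs, hrhs]
  refine div_le_div_of_nonneg_right ?_ hc₄.le
  have hΔV : 0 < Δ ^ 2 * V := by positivity
  have h1 : 36 * Δ ^ 2 * V * S₀ ^ 2 * s ≤ 576 * Δ ^ 2 * V * s ^ 3 * (M * E ^ (n + 1)) := by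
    have : S₀ ^ 2 * s ≤ 16 * s ^ 3 := by nlinarith
    calc 36 * Δ ^ 2 * V * S₀ ^ 2 * s = 36 * (Δ ^ 2 * V) * (S₀ ^ 2 * s) * 1 := by ring
      _ ≤ 36 * (Δ ^ 2 * V) * (16 * s ^ 3) * (M * E ^ (n + 1)) := by gcongr
      _ = 576 * Δ ^ 2 * V * s ^ 3 * (M * E ^ (n + 1)) := by ring
  have h2 : 2 * Δ ^ 2 * V * E ^ (n - 1) * S₀ ^ 3 ≤ 128 * Δ ^ 2 * V * s ^ 3 * (M * E ^ (n + 1)) := by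
    calc 2 * Δ ^ 2 * V * E ^ (n - 1) * S₀ ^ 3 = 2 * (Δ ^ 2 * V) * (1 * E ^ (n - 1)) * S₀ ^ 3 := by ring
      _ ≤ 2 * (Δ ^ 2 * V) * (M * E ^ (n + 1)) * (64 * s ^ 3) := by gcongr
      _ = 128 * Δ ^ 2 * V * s ^ 3 * (M * E ^ (n + 1)) := by ring
  linarith

end Pieces


section Pieces2

variable {X τ : ℝ} {n : ℕ} {m : Fin (n + 1) → ℕ}

/-- **`B₁ ≤ 3(2C₉ + 1)N₁·f₉`** once `e^{−c₉√(log A₀)} ≤ f₉`, `18 log X/√A₀ ≤ f₉`, `(1 + δ)^n ≤ 3`, `Mξ log X ≥ 1`. [folklore] -/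
theorem bB1_le (hX : 1 < X) (hξ1 : 1 ≤ hbXi τ * Real.log X) (hM : 1 ≤ ∏ i, (m i : ℝ))
    {c₃ V A₀ C₉ c₉ Cθ cθ f₉ : ℝ} (hc₃ : 0 < c₃) (hV : 0 < V) (hC₉ : 0 ≤ C₉)
    (he₉ : Real.exp (-(c₉ * Real.sqrt (Real.log A₀))) ≤ f₉) (hlog : 12 * (3 / 2 * Real.log X) / Real.sqrt A₀ ≤ f₉)
    (hδ0 : 0 ≤ 1 + (Cθ * Real.exp (-cθ * Real.sqrt (τ * Real.log X)) + (8 + 2 * Cθ) / (hbXi τ * Real.log X)))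
    (hδ : (1 + (Cθ * Real.exp (-cθ * Real.sqrt (τ * Real.log X)) + (8 + 2 * Cθ) / (hbXi τ * Real.log X))) ^ n ≤ 3) :
    bB1 X τ m c₃ V A₀ C₉ c₉ Cθ cθ ≤ 3 * (2 * C₉ + 1) * (13 * c₃ ^ 3 + 1) * (V * f₉) := by
  have hlogX := Real.log_pos hX
  have hden : 1 ≤ (∏ i, (m i : ℝ)) * (hbXi τ * Real.log X) := one_le_mul_of_one_le_of_one_le hM hξ1
  have hN : 0 ≤ nMax c₃ V := by rw [nMax]; positivity
  have hF : 2 * C₉ * Real.exp (-(c₉ * Real.sqrt (Real.log A₀))) + 12 * (3 / 2 * Real.log X) / Real.sqrt A₀ ≤ (2 * C₉ + 1) * f₉ := by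
    nlinarith
  have hF0 : 0 ≤ 2 * C₉ * Real.exp (-(c₉ * Real.sqrt (Real.log A₀))) + 12 * (3 / 2 * Real.log X) / Real.sqrt A₀ := by
    have : 0 ≤ 12 * (3 / 2 * Real.log X) / Real.sqrt A₀ := by positivity
    positivity
  rw [bB1]
  calc nMax c₃ V * (2 * C₉ * Real.exp (-(c₉ * Real.sqrt (Real.log A₀))) + 12 * (3 / 2 * Real.log X) / Real.sqrt A₀) *
        (1 + (Cθ * Real.exp (-cθ * Real.sqrt (τ * Real.log X)) + (8 + 2 * Cθ) / (hbXi τ * Real.log X))) ^ n /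
        ((∏ i, (m i : ℝ)) * (hbXi τ * Real.log X))
      ≤ nMax c₃ V * (2 * C₉ * Real.exp (-(c₉ * Real.sqrt (Real.log A₀))) + 12 * (3 / 2 * Real.log X) / Real.sqrt A₀) *
        (1 + (Cθ * Real.exp (-cθ * Real.sqrt (τ * Real.log X)) + (8 + 2 * Cθ) / (hbXi τ * Real.log X))) ^ n :=
        div_le_self (by positivity) hden
    _ ≤ nMax c₃ V * ((2 * C₉ + 1) * f₉) * 3 :=
        mul_le_mul (mul_le_mul_of_nonneg_left hF hN) hδ (pow_nonneg hδ0 n) (mul_nonneg hN (hF0.trans hF))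
    _ = 3 * (2 * C₉ + 1) * (13 * c₃ ^ 3 + 1) * (V * f₉) := by rw [nMax]; ring

/-- **`B₂ ≤ 9C₄N₁·e₂/τ`** once `e^{−c₂√(τ log X)} ≤ e₂`, `(1 + c₁/(ξ log X))^n ≤ 3`, `n + 1 ≤ 3/(2τ)`, `M ≥ 1`, `ξ log X ≥ 1`. [folklore] -/
theorem bB2_le (hτ : 0 < τ) (hξ1 : 1 ≤ hbXi τ * Real.log X) (hM : 1 ≤ ∏ i, (m i : ℝ))
    {c₃ V c₁ c₂ C₄ e₂ : ℝ} (hc₃ : 0 < c₃) (hV : 0 < V) (hc₁ : 0 ≤ c₁) (hC₄ : 0 ≤ C₄)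
    (he₂ : Real.exp (-c₂ * Real.sqrt (τ * Real.log X)) ≤ e₂) (hpow : (1 + c₁ / (hbXi τ * Real.log X)) ^ n ≤ 3)
    (hn : (n : ℝ) + 1 ≤ 3 / (2 * τ)) :
    bB2 X τ m c₃ V c₁ c₂ C₄ ≤ 9 * C₄ * (13 * c₃ ^ 3 + 1) * (V * e₂ / τ) := by
  set E := hbXi τ * Real.log X with hE
  have hE0 : 0 < E := by linarith
  set M := ∏ i, (m i : ℝ) with hMdef
  have hN : 0 ≤ nMax c₃ V := by rw [nMax]; positivity
  have hcE : (c₁ + E) ^ n ≤ 3 * E ^ n := by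
    have : c₁ + E = E * (1 + c₁ / E) := by field_simp; ring
    rw [this, mul_pow, mul_comm]
    exact mul_le_mul_of_nonneg_right hpow (by positivity)
  rw [bB2, ← hE, ← hMdef]
  have hden : 0 < M * E ^ (n + 1) := by positivity
  rw [div_le_iff₀ hden]
  have he0 : 0 ≤ e₂ := (Real.exp_pos _).le.trans he₂
  calc 2 * (C₄ * ((n : ℝ) + 1) * nMax c₃ V * (c₁ + E) ^ n * Real.exp (-c₂ * Real.sqrt (τ * Real.log X)))
      ≤ 2 * (C₄ * (3 / (2 * τ)) * nMax c₃ V * (3 * E ^ n) * e₂) := by gcongr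
    _ = 9 * C₄ * nMax c₃ V * (e₂ / τ) * (1 * E ^ n) := by ring
    _ ≤ 9 * C₄ * nMax c₃ V * (e₂ / τ) * (M * E ^ n * E) := by
        apply mul_le_mul_of_nonneg_left _ (by positivity)
        calc 1 * E ^ n ≤ M * E ^ n := by gcongr
          _ = M * E ^ n * 1 := (mul_one _).symm
          _ ≤ M * E ^ n * E := mul_le_mul_of_nonneg_left hξ1 (by positivity)
    _ = 9 * C₄ * (13 * c₃ ^ 3 + 1) * (V * e₂ / τ) * (M * E ^ (n + 1)) := by rw [nMax]; ring

/-- **The `Err` term**: with `B₁ ≤ Vu₁`, `B₂ ≤ Vu₂`, `Mξ log X ≥ 1`, `S₀³ ≤ 64c₃³V`, `0 < Δ ≤ 1`: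
`Err·S₀³/(γ₀Δ³V) ≤ (64c₃³/γ₀)·V·(3εΔ⁻² + 3εΔ⁻³u₂ + 5Δ⁻⁵u₁ + Δ⁻¹u₂)`, `ε = 1/(Δ√K₀)`. [folklore] -/
theorem bErr_term_le (hX : 1 < X) (hξ1 : 1 ≤ hbXi τ * Real.log X) (hM : 1 ≤ ∏ i, (m i : ℝ))
    {c₃ V Δ : ℝ} {K₀ : ℕ} {A₀ C₉ c₉ Cθ cθ c₁ c₂ C₄ S₀ u₁ u₂ : ℝ} (hc₃ : 0 < c₃) (hV : 0 < V) (hΔ : 0 < Δ) (hΔ1 : Δ ≤ 1)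
    (hS₀0 : 0 ≤ S₀) (hS₀ : S₀ ≤ 4 * (c₃ * V ^ (1 / 3 : ℝ)))
    (hB1 : bB1 X τ m c₃ V A₀ C₉ c₉ Cθ cθ ≤ V * u₁) (hB2 : bB2 X τ m c₃ V c₁ c₂ C₄ ≤ V * u₂)
    (hB10 : 0 ≤ bB1 X τ m c₃ V A₀ C₉ c₉ Cθ cθ) (hB20 : 0 ≤ bB2 X τ m c₃ V c₁ c₂ C₄) :
    bErr X τ m c₃ V Δ K₀ A₀ C₉ c₉ Cθ cθ c₁ c₂ C₄ * S₀ ^ 3 / (gamma₀ * Δ ^ 3 * V) ≤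
      64 * c₃ ^ 3 / gamma₀ * V *
        (3 * (1 / Δ / Real.sqrt K₀) * Δ⁻¹ ^ 2 + 3 * (1 / Δ / Real.sqrt K₀) * Δ⁻¹ ^ 3 * u₂ + 5 * Δ⁻¹ ^ 5 * u₁ + Δ⁻¹ * u₂) := by
  have hγ := gamma₀_pos
  have hlogX := Real.log_pos hX
  set s := c₃ * V ^ (1 / 3 : ℝ) with hs
  have hs0 : 0 < s := by positivity
  have hs3 : s ^ 3 = c₃ ^ 3 * V := by
    rw [hs, mul_pow, ← Real.rpow_natCast (V ^ (1 / 3 : ℝ)) 3, ← Real.rpow_mul hV.le]; norm_num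
  have hS3 : S₀ ^ 3 ≤ 64 * (c₃ ^ 3 * V) := by
    calc S₀ ^ 3 ≤ (4 * s) ^ 3 := pow_le_pow_left₀ hS₀0 hS₀ 3
      _ = 64 * s ^ 3 := by ring
      _ = 64 * (c₃ ^ 3 * V) := by rw [hs3]
  set ε := 1 / Δ / Real.sqrt K₀ with hε
  have hε0 : 0 ≤ ε := by positivity
  have hu₁ : 0 ≤ u₁ := by
    by_contra h; push Not at h
    have : V * u₁ < 0 := mul_neg_of_pos_of_neg hV h
    linarith
  have hu₂ : 0 ≤ u₂ := by
    by_contra h; push Not at h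
    have : V * u₂ < 0 := mul_neg_of_pos_of_neg hV h
    linarith
  -- `bEA ≤ V(Δ + u₂)`
  have hEA : bEA X τ m c₃ V Δ c₁ c₂ C₄ ≤ V * (Δ + u₂) := by
    rw [bEA]
    have hden : 1 ≤ (∏ i, (m i : ℝ)) * (hbXi τ * Real.log X) := one_le_mul_of_one_le_of_one_le hM hξ1
    have : Δ * V / ((∏ i, (m i : ℝ)) * (hbXi τ * Real.log X)) ≤ Δ * V := div_le_self (by positivity) hden
    linarith
  -- `bErr ≤ V·[3ε(Δ+u₂) + 5Δ⁻²u₁ + Δ²u₂]`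
  have hcoef : (1 + 1 / Δ) ^ 2 + 1 ≤ 5 * Δ⁻¹ ^ 2 := by
    have h1 : 1 ≤ Δ⁻¹ := one_le_inv_iff₀.mpr ⟨hΔ, hΔ1⟩
    rw [one_div]; nlinarith
  have hErr : bErr X τ m c₃ V Δ K₀ A₀ C₉ c₉ Cθ cθ c₁ c₂ C₄ ≤ V * (3 * ε * (Δ + u₂) + 5 * Δ⁻¹ ^ 2 * u₁ + Δ ^ 2 * u₂) := by
    rw [bErr, ← hε]
    have h1 : 3 * ε * bEA X τ m c₃ V Δ c₁ c₂ C₄ ≤ 3 * ε * (V * (Δ + u₂)) := mul_le_mul_of_nonneg_left hEA (by positivity)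
    have h2 : ((1 + 1 / Δ) ^ 2 + 1) * bB1 X τ m c₃ V A₀ C₉ c₉ Cθ cθ ≤ (5 * Δ⁻¹ ^ 2) * (V * u₁) :=
      mul_le_mul hcoef hB1 hB10 (by positivity)
    have h3 : Δ ^ 2 * bB2 X τ m c₃ V c₁ c₂ C₄ ≤ Δ ^ 2 * (V * u₂) := mul_le_mul_of_nonneg_left hB2 (by positivity)
    linarith
  have hErr0 : 0 ≤ bErr X τ m c₃ V Δ K₀ A₀ C₉ c₉ Cθ cθ c₁ c₂ C₄ := by
    rw [bErr, ← hε]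
    have : 0 ≤ bEA X τ m c₃ V Δ c₁ c₂ C₄ := by rw [bEA]; positivity
    positivity
  -- divide
  have hden : 0 < gamma₀ * Δ ^ 3 * V := by positivity
  rw [div_le_iff₀ hden]
  calc bErr X τ m c₃ V Δ K₀ A₀ C₉ c₉ Cθ cθ c₁ c₂ C₄ * S₀ ^ 3
      ≤ (V * (3 * ε * (Δ + u₂) + 5 * Δ⁻¹ ^ 2 * u₁ + Δ ^ 2 * u₂)) * (64 * (c₃ ^ 3 * V)) :=
        mul_le_mul hErr hS3 (by positivity) (by positivity)
    _ = 64 * c₃ ^ 3 / gamma₀ * V *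
        (3 * ε * Δ⁻¹ ^ 2 + 3 * ε * Δ⁻¹ ^ 3 * u₂ + 5 * Δ⁻¹ ^ 5 * u₁ + Δ⁻¹ * u₂) * (gamma₀ * Δ ^ 3 * V) := by
        field_simp

set_option maxHeartbeats 400000 in
/-- **The total**: `lemma92Bound ≤ C_tot·V·E` once `Δ ≤ E` and the four products `Δ⁻³g`, `Δ⁻⁴g·e₂/τ`, `Δ⁻⁵f₉`, `Δ⁻¹e₂/τ` are `≤ E`
(`ε ≤ √2Δ⁻¹g`, `u₁ = 3(2C₉+1)N₁/V·f₉`, `u₂ = 9C₄N₁/V·e₂/τ`). [cite: HeathBrownActa2001, §9 p. 60] -/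
theorem lemma92Bound_le (hτ : 0 < τ) (hX : 1 < X) (hξ1 : 1 ≤ hbXi τ * Real.log X) (hM : 1 ≤ ∏ i, (m i : ℝ))
    {c₃ c₄ C₀ V Δ S₀ : ℝ} {K₀ : ℕ} {A₀ C₉ c₉ Cθ cθ c₁ c₂ C₄ f₉ e₂ g E : ℝ}
    (hc₃ : 0 < c₃) (hc₄ : 0 < c₄) (hC₀ : 0 ≤ C₀) (hV : 0 < V) (hΔ : 0 < Δ) (hΔ1 : Δ ≤ 1) (hS₀0 : 0 ≤ S₀)
    (hs1 : 1 ≤ c₃ * V ^ (1 / 3 : ℝ)) (hS₀ : S₀ ≤ 4 * (c₃ * V ^ (1 / 3 : ℝ))) (hsΔ : (c₃ * V ^ (1 / 3 : ℝ)) ^ 2 ≤ 4 * c₃ ^ 3 * V * Δ)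
    (hC₉ : 0 ≤ C₉) (hC₄ : 0 ≤ C₄) (hc₁ : 0 ≤ c₁) (hf₉ : 0 ≤ f₉) (he₂0 : 0 ≤ e₂)
    (he₉ : Real.exp (-(c₉ * Real.sqrt (Real.log A₀))) ≤ f₉) (hlog : 12 * (3 / 2 * Real.log X) / Real.sqrt A₀ ≤ f₉)
    (hδ0 : 0 ≤ 1 + (Cθ * Real.exp (-cθ * Real.sqrt (τ * Real.log X)) + (8 + 2 * Cθ) / (hbXi τ * Real.log X)))
    (hδ : (1 + (Cθ * Real.exp (-cθ * Real.sqrt (τ * Real.log X)) + (8 + 2 * Cθ) / (hbXi τ * Real.log X))) ^ n ≤ 3)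
    (he₂ : Real.exp (-c₂ * Real.sqrt (τ * Real.log X)) ≤ e₂) (hpow : (1 + c₁ / (hbXi τ * Real.log X)) ^ n ≤ 3)
    (hn : (n : ℝ) + 1 ≤ 3 / (2 * τ))
    (hε : 1 / Δ / Real.sqrt K₀ ≤ Real.sqrt 2 * Δ⁻¹ * g)
    (hΔE : Δ ≤ E) (hx1 : Δ⁻¹ ^ 3 * g ≤ E) (hx2 : Δ⁻¹ ^ 4 * g * (e₂ / τ) ≤ E) (hx3 : Δ⁻¹ ^ 5 * f₉ ≤ E) (hx4 : Δ⁻¹ * (e₂ / τ) ≤ E) :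
    lemma92Bound X τ m c₃ c₄ V Δ S₀ K₀ A₀ C₉ c₉ Cθ cθ c₁ c₂ C₄ C₀ ≤
      ((16 * Real.pi * (5 + 3 * (2 * C₀ * (1 + 1 / c₄))) ^ 3 +
          64 * (5 + 2 * (C₀ * (1 + 2 / c₄) * (5 + 2 * (2 * C₀ * (1 + 1 / c₄))))) ^ 2 *
            (2 * (C₀ * (1 + 2 / c₄) * (5 + 2 * (2 * C₀ * (1 + 1 / c₄)))) + 4)) * c₃ ^ 3 +
        704 * c₃ ^ 3 / (c₄ * gamma₀) +
        64 * c₃ ^ 3 / gamma₀ * (3 * Real.sqrt 2 + 3 * Real.sqrt 2 * (9 * C₄ * (13 * c₃ ^ 3 + 1)) +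
          5 * (3 * (2 * C₉ + 1) * (13 * c₃ ^ 3 + 1)) + 9 * C₄ * (13 * c₃ ^ 3 + 1))) * (V * E) := by
  have hγ := gamma₀_pos
  set u₁ := 3 * (2 * C₉ + 1) * (13 * c₃ ^ 3 + 1) * f₉ with hu₁
  set u₂ := 9 * C₄ * (13 * c₃ ^ 3 + 1) * (e₂ / τ) with hu₂
  have hu₁0 : 0 ≤ u₁ := by positivity
  have hu₂0 : 0 ≤ u₂ := by positivity
  have hB1 : bB1 X τ m c₃ V A₀ C₉ c₉ Cθ cθ ≤ V * u₁ := by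
    have := bB1_le (m := m) hX hξ1 hM hc₃ hV hC₉ he₉ hlog hδ0 hδ; rw [hu₁]; linarith
  have hB2 : bB2 X τ m c₃ V c₁ c₂ C₄ ≤ V * u₂ := by
    have := bB2_le (m := m) hτ hξ1 hM hc₃ hV hc₁ hC₄ he₂ hpow hn; rw [hu₂]
    calc bB2 X τ m c₃ V c₁ c₂ C₄ ≤ 9 * C₄ * (13 * c₃ ^ 3 + 1) * (V * e₂ / τ) := this
      _ = V * (9 * C₄ * (13 * c₃ ^ 3 + 1) * (e₂ / τ)) := by ring
  have hlogX := Real.log_pos hX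
  have hB10 : 0 ≤ bB1 X τ m c₃ V A₀ C₉ c₉ Cθ cθ := by
    rw [bB1]; have : 0 ≤ nMax c₃ V := by rw [nMax]; positivity
    have : 0 ≤ 12 * (3 / 2 * Real.log X) / Real.sqrt A₀ := by positivity
    positivity
  have hB20 : 0 ≤ bB2 X τ m c₃ V c₁ c₂ C₄ := by
    rw [bB2]; have : 0 ≤ nMax c₃ V := by rw [nMax]; positivity
    have := hbXi_pos hτ
    positivity
  have hT1 := bG_le hc₃ hc₄ hC₀ hV hΔ hΔ1 hS₀0 hs1 hS₀ hsΔ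
  have hT2 := bErr8_div_le (n := n) hX hξ1 hM hc₃ hc₄ hV hΔ hS₀0 hS₀
  have hT3 := bErr_term_le (m := m) (K₀ := K₀) (A₀ := A₀) (C₉ := C₉) (c₉ := c₉) (Cθ := Cθ) (cθ := cθ) (c₁ := c₁) (c₂ := c₂) (C₄ := C₄)
    hX hξ1 hM hc₃ hV hΔ hΔ1 hS₀0 hS₀ hB1 hB2 hB10 hB20
  -- the bracket of `hT3`
  have hΔi : 0 < Δ⁻¹ := inv_pos.mpr hΔ
  have hbr : 3 * (1 / Δ / Real.sqrt K₀) * Δ⁻¹ ^ 2 + 3 * (1 / Δ / Real.sqrt K₀) * Δ⁻¹ ^ 3 * u₂ + 5 * Δ⁻¹ ^ 5 * u₁ + Δ⁻¹ * u₂ ≤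
      (3 * Real.sqrt 2 + 3 * Real.sqrt 2 * (9 * C₄ * (13 * c₃ ^ 3 + 1)) + 5 * (3 * (2 * C₉ + 1) * (13 * c₃ ^ 3 + 1)) +
        9 * C₄ * (13 * c₃ ^ 3 + 1)) * E := by
    have hε0 : 0 ≤ 1 / Δ / Real.sqrt K₀ := by positivity
    have a1 : 3 * (1 / Δ / Real.sqrt K₀) * Δ⁻¹ ^ 2 ≤ 3 * Real.sqrt 2 * E := by
      calc 3 * (1 / Δ / Real.sqrt K₀) * Δ⁻¹ ^ 2 ≤ 3 * (Real.sqrt 2 * Δ⁻¹ * g) * Δ⁻¹ ^ 2 := by gcongr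
        _ = 3 * Real.sqrt 2 * (Δ⁻¹ ^ 3 * g) := by ring
        _ ≤ 3 * Real.sqrt 2 * E := by gcongr
    have a2 : 3 * (1 / Δ / Real.sqrt K₀) * Δ⁻¹ ^ 3 * u₂ ≤ 3 * Real.sqrt 2 * (9 * C₄ * (13 * c₃ ^ 3 + 1)) * E := by
      calc 3 * (1 / Δ / Real.sqrt K₀) * Δ⁻¹ ^ 3 * u₂ ≤ 3 * (Real.sqrt 2 * Δ⁻¹ * g) * Δ⁻¹ ^ 3 * u₂ := by gcongr
        _ = 3 * Real.sqrt 2 * (9 * C₄ * (13 * c₃ ^ 3 + 1)) * (Δ⁻¹ ^ 4 * g * (e₂ / τ)) := by rw [hu₂]; ring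
        _ ≤ 3 * Real.sqrt 2 * (9 * C₄ * (13 * c₃ ^ 3 + 1)) * E := by gcongr
    have a3 : 5 * Δ⁻¹ ^ 5 * u₁ ≤ 5 * (3 * (2 * C₉ + 1) * (13 * c₃ ^ 3 + 1)) * E := by
      calc 5 * Δ⁻¹ ^ 5 * u₁ = 5 * (3 * (2 * C₉ + 1) * (13 * c₃ ^ 3 + 1)) * (Δ⁻¹ ^ 5 * f₉) := by rw [hu₁]; ring
        _ ≤ 5 * (3 * (2 * C₉ + 1) * (13 * c₃ ^ 3 + 1)) * E := by gcongr
    have a4 : Δ⁻¹ * u₂ ≤ 9 * C₄ * (13 * c₃ ^ 3 + 1) * E := by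
      calc Δ⁻¹ * u₂ = 9 * C₄ * (13 * c₃ ^ 3 + 1) * (Δ⁻¹ * (e₂ / τ)) := by rw [hu₂]; ring
        _ ≤ 9 * C₄ * (13 * c₃ ^ 3 + 1) * E := by gcongr
    linarith
  have hE0 : 0 ≤ E := hΔ.le.trans hΔE
  rw [lemma92Bound]
  have hT3' : bErr X τ m c₃ V Δ K₀ A₀ C₉ c₉ Cθ cθ c₁ c₂ C₄ * S₀ ^ 3 / (gamma₀ * Δ ^ 3 * V) ≤
      64 * c₃ ^ 3 / gamma₀ * (3 * Real.sqrt 2 + 3 * Real.sqrt 2 * (9 * C₄ * (13 * c₃ ^ 3 + 1)) +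
        5 * (3 * (2 * C₉ + 1) * (13 * c₃ ^ 3 + 1)) + 9 * C₄ * (13 * c₃ ^ 3 + 1)) * (V * E) := by
    refine hT3.trans ?_
    calc 64 * c₃ ^ 3 / gamma₀ * V * (3 * (1 / Δ / Real.sqrt K₀) * Δ⁻¹ ^ 2 + 3 * (1 / Δ / Real.sqrt K₀) * Δ⁻¹ ^ 3 * u₂ +
          5 * Δ⁻¹ ^ 5 * u₁ + Δ⁻¹ * u₂)
        ≤ 64 * c₃ ^ 3 / gamma₀ * V * ((3 * Real.sqrt 2 + 3 * Real.sqrt 2 * (9 * C₄ * (13 * c₃ ^ 3 + 1)) +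
            5 * (3 * (2 * C₉ + 1) * (13 * c₃ ^ 3 + 1)) + 9 * C₄ * (13 * c₃ ^ 3 + 1)) * E) :=
          mul_le_mul_of_nonneg_left hbr (by positivity)
      _ = _ := by ring
  have hΔV : Δ * V ≤ V * E := by rw [mul_comm]; exact mul_le_mul_of_nonneg_left hΔE hV.le
  have hk1 : 0 ≤ (16 * Real.pi * (5 + 3 * (2 * C₀ * (1 + 1 / c₄))) ^ 3 +
      64 * (5 + 2 * (C₀ * (1 + 2 / c₄) * (5 + 2 * (2 * C₀ * (1 + 1 / c₄))))) ^ 2 *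
        (2 * (C₀ * (1 + 2 / c₄) * (5 + 2 * (2 * C₀ * (1 + 1 / c₄)))) + 4)) * c₃ ^ 3 := by
    have := Real.pi_pos; positivity
  have hk2 : 0 ≤ 704 * c₃ ^ 3 / (c₄ * gamma₀) := by positivity
  have hT1' := hT1.trans (mul_le_mul_of_nonneg_left hΔV hk1)
  have hT2' := hT2.trans (mul_le_mul_of_nonneg_left hΔV hk2)
  linarith

end Pieces2

/-! ### The parameters for large `X` -/

/-- **Eventually-in-`X` facts on `τ = (log log X)^{−ϖ}`, `ξ = τ⁵`, `ℓ = log L = (τ/2) log X`**: `X ≥ 2`, `0 < τ ≤ 1/4`,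
`√ℓ ≥ T₀`, `ξ log X ≥ 1`, `τ⁶ log X ≥ B`, `1/τ ≤ e^{c√ℓ}`, `log log X ≤ ℓ/4`; all from `C(log log X)^s ≤ log X`
(`eventually_mul_loglog_rpow_le`). [folklore] -/
theorem eventually_lemma92_params {ϖ : ℝ} (hϖ0 : 0 < ϖ) (T₀ B : ℝ) {c : ℝ} (hc : 0 < c) :
    ∀ᶠ X : ℝ in atTop,
      2 ≤ X ∧ 0 < hbTau ϖ X ∧ hbTau ϖ X ≤ 1 / 4 ∧
        T₀ ≤ Real.sqrt (Real.log (hbL X (hbTau ϖ X))) ∧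
        1 ≤ hbXi (hbTau ϖ X) * Real.log X ∧
        B ≤ hbTau ϖ X ^ 6 * Real.log X ∧
        1 / hbTau ϖ X ≤ Real.exp (c * Real.sqrt (Real.log (hbL X (hbTau ϖ X)))) ∧
        Real.log (Real.log X) ≤ Real.log (hbL X (hbTau ϖ X)) / 4 := by
  have hT : Tendsto (fun X : ℝ => Real.log (Real.log X)) atTop atTop :=
    Real.tendsto_log_atTop.comp Real.tendsto_log_atTop
  have hτ0 : Tendsto (fun X : ℝ => hbTau ϖ X) atTop (𝓝 0) := by
    have : (fun X : ℝ => hbTau ϖ X) = fun X => (Real.log (Real.log X)) ^ (-ϖ) := rfl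
    rw [this]
    exact (tendsto_rpow_neg_atTop hϖ0).comp hT
  have hτ4 : ∀ᶠ X : ℝ in atTop, hbTau ϖ X ≤ 1 / 4 := hτ0.eventually (ge_mem_nhds (by norm_num))
  filter_upwards [eventually_ge_atTop (2 : ℝ), hτ4, hT.eventually (eventually_ge_atTop (1 : ℝ)),
    eventually_mul_loglog_rpow_le ϖ (2 * (max T₀ 0) ^ 2), eventually_mul_loglog_rpow_le (5 * ϖ) 1,
    eventually_mul_loglog_rpow_le (6 * ϖ) B, eventually_mul_loglog_rpow_le (2 + ϖ) (2 * ϖ ^ 2 / c ^ 2),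
    eventually_mul_loglog_rpow_le (1 + ϖ) 8] with X hX2 hτ4X hM1 h1 h2 h3 h4 h5
  set Lx := Real.log X with hLx
  set M := Real.log Lx with hM
  have hM1' : (1 : ℝ) ≤ M := hM1
  have hX0 : 0 < X := by linarith
  have hLx0 : 0 < Lx := Real.log_pos (by linarith)
  have hM0 : 0 < M := by linarith
  have hτ : hbTau ϖ X = M ^ (-ϖ) := rfl
  set τ := hbTau ϖ X with hτdef
  have hτpos : 0 < τ := by rw [hτ]; exact Real.rpow_pos_of_pos hM0 _
  -- `τ · M^{s+ϖ} = M^s`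
  have key : ∀ s : ℝ, τ * M ^ (s + ϖ) = M ^ s := fun s => by
    rw [hτ, ← Real.rpow_add hM0]; ring_nf
  have keyn : ∀ k : ℕ, τ ^ k * M ^ ((k : ℝ) * ϖ) = 1 := fun k => by
    rw [hτ, ← Real.rpow_natCast, ← Real.rpow_mul hM0.le, ← Real.rpow_add hM0]; ring_nf; exact Real.rpow_zero M
  have hL : Real.log (hbL X τ) = τ / 2 * Lx := by rw [hbL, Real.log_rpow hX0]
  have hℓ0 : 0 ≤ τ / 2 * Lx := by positivity
  refine ⟨hX2, hτpos, hτ4X, ?_, ?_, ?_, ?_, ?_⟩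
  · -- `√ℓ ≥ T₀`: `ℓ ≥ (max T₀ 0)²`
    rw [hL]
    have hℓ : (max T₀ 0) ^ 2 ≤ τ / 2 * Lx := by
      have : τ * (2 * (max T₀ 0) ^ 2 * M ^ ϖ) ≤ τ * Lx := mul_le_mul_of_nonneg_left h1 hτpos.le
      have h' : τ * (2 * (max T₀ 0) ^ 2 * M ^ ϖ) = 2 * (max T₀ 0) ^ 2 := by
        have := key 0
        rw [zero_add, Real.rpow_zero] at this
        calc τ * (2 * (max T₀ 0) ^ 2 * M ^ ϖ) = 2 * (max T₀ 0) ^ 2 * (τ * M ^ ϖ) := by ring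
          _ = 2 * (max T₀ 0) ^ 2 := by rw [this, mul_one]
      linarith
    calc T₀ ≤ max T₀ 0 := le_max_left _ _
      _ = Real.sqrt ((max T₀ 0) ^ 2) := (Real.sqrt_sq (le_max_right _ _)).symm
      _ ≤ Real.sqrt (τ / 2 * Lx) := Real.sqrt_le_sqrt hℓ
  · -- `ξ log X ≥ 1`
    rw [hbXi]
    have h := keyn 5
    have : τ ^ 5 * (1 * M ^ (5 * ϖ)) ≤ τ ^ 5 * Lx := mul_le_mul_of_nonneg_left h2 (by positivity)
    rw [one_mul, show ((5 : ℕ) : ℝ) * ϖ = 5 * ϖ by norm_num] at *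
    linarith
  · -- `τ⁶ log X ≥ B`
    have h := keyn 6
    have : τ ^ 6 * (B * M ^ (6 * ϖ)) ≤ τ ^ 6 * Lx := mul_le_mul_of_nonneg_left h3 (by positivity)
    have h' : τ ^ 6 * (B * M ^ (6 * ϖ)) = B := by
      rw [show ((6 : ℕ) : ℝ) * ϖ = 6 * ϖ by norm_num] at h
      calc τ ^ 6 * (B * M ^ (6 * ϖ)) = B * (τ ^ 6 * M ^ (6 * ϖ)) := by ring
        _ = B := by rw [h, mul_one]
    linarith
  · -- `1/τ ≤ exp(c √ℓ)`: `1/τ = M^ϖ = exp(ϖ log M) ≤ exp(ϖ M)` and `ϖ M ≤ c √ℓ`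
    rw [hL]
    have hinv : 1 / τ = M ^ ϖ := by rw [hτ, Real.rpow_neg hM0.le, one_div, inv_inv]
    rw [hinv]
    have hsq : (ϖ * M) ^ 2 ≤ c ^ 2 * (τ / 2 * Lx) := by
      have : τ * (2 * ϖ ^ 2 / c ^ 2 * M ^ (2 + ϖ)) ≤ τ * Lx := mul_le_mul_of_nonneg_left h4 hτpos.le
      have h' : τ * (2 * ϖ ^ 2 / c ^ 2 * M ^ (2 + ϖ)) = 2 * ϖ ^ 2 / c ^ 2 * M ^ 2 := by
        have := key 2
        calc τ * (2 * ϖ ^ 2 / c ^ 2 * M ^ (2 + ϖ)) = 2 * ϖ ^ 2 / c ^ 2 * (τ * M ^ (2 + ϖ)) := by ring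
          _ = 2 * ϖ ^ 2 / c ^ 2 * M ^ 2 := by
              rw [this, show ((2 : ℝ)) = ((2 : ℕ) : ℝ) by norm_num, Real.rpow_natCast]
      have h3' : 2 * ϖ ^ 2 / c ^ 2 * M ^ 2 ≤ τ * Lx := by linarith
      have : (ϖ * M) ^ 2 = (2 * ϖ ^ 2 / c ^ 2 * M ^ 2) * (c ^ 2 / 2) := by field_simp
      rw [this]
      calc 2 * ϖ ^ 2 / c ^ 2 * M ^ 2 * (c ^ 2 / 2) ≤ τ * Lx * (c ^ 2 / 2) := mul_le_mul_of_nonneg_right h3' (by positivity)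
        _ = c ^ 2 * (τ / 2 * Lx) := by ring
    have hϖM : ϖ * M ≤ c * Real.sqrt (τ / 2 * Lx) := by
      have h0 : 0 ≤ ϖ * M := by positivity
      have hR0 : 0 ≤ c * Real.sqrt (τ / 2 * Lx) := mul_nonneg hc.le (Real.sqrt_nonneg _)
      have : (ϖ * M) ^ 2 ≤ (c * Real.sqrt (τ / 2 * Lx)) ^ 2 := by
        rw [mul_pow c, Real.sq_sqrt hℓ0]; exact hsq
      exact (pow_le_pow_iff_left₀ h0 hR0 (by norm_num : (2 : ℕ) ≠ 0)).mp this
    calc M ^ ϖ = Real.exp (Real.log M * ϖ) := Real.rpow_def_of_pos hM0 ϖ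
      _ ≤ Real.exp (ϖ * M) := Real.exp_le_exp.mpr (by nlinarith [Real.log_le_sub_one_of_pos hM0])
      _ ≤ Real.exp (c * Real.sqrt (τ / 2 * Lx)) := Real.exp_le_exp.mpr hϖM
  · -- `M ≤ ℓ/4`
    rw [hL]
    have : τ * (8 * M ^ (1 + ϖ)) ≤ τ * Lx := mul_le_mul_of_nonneg_left h5 hτpos.le
    have h' : τ * (8 * M ^ (1 + ϖ)) = 8 * M := by
      have := key 1
      rw [Real.rpow_one] at this
      calc τ * (8 * M ^ (1 + ϖ)) = 8 * (τ * M ^ (1 + ϖ)) := by ring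
        _ = 8 * M := by rw [this]
    change M ≤ τ / 2 * Lx / 4
    linarith

/-! ### Small analytic facts -/

/-- `log ℓ ≤ 2√ℓ` for `ℓ > 0`. [folklore] -/
theorem log_le_two_mul_sqrt {ℓ : ℝ} (hℓ : 0 < ℓ) : Real.log ℓ ≤ 2 * Real.sqrt ℓ := by
  have hs : 0 < Real.sqrt ℓ := Real.sqrt_pos.mpr hℓ
  have h := Real.log_le_sub_one_of_pos hs
  have : Real.log ℓ = 2 * Real.log (Real.sqrt ℓ) := by
    conv_lhs => rw [← Real.sq_sqrt hℓ.le]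
    rw [Real.log_pow]; norm_num
  rw [this]; linarith

/-- `exp 4 > 26`. [folklore] -/
theorem exp_four_gt : (26 : ℝ) < Real.exp 4 := by
  have h := Real.exp_one_gt_d9
  have : Real.exp 4 = Real.exp 1 ^ 4 := by rw [← Real.exp_nat_mul]; norm_num
  rw [this]
  have h2 : (2.7182818283 : ℝ) ^ 4 ≤ Real.exp 1 ^ 4 := pow_le_pow_left₀ (by norm_num) h.le 4
  have h3 : (26 : ℝ) < (2.7182818283 : ℝ) ^ 4 := by norm_num
  exact h3.trans_le h2

/-- `(1 + δ)^n ≤ 3` when `0 ≤ δ` and `nδ ≤ 1`. [folklore] -/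
theorem one_add_pow_le_three {δ : ℝ} (hδ : 0 ≤ δ) {n : ℕ} (h : (n : ℝ) * δ ≤ 1) : (1 + δ) ^ n ≤ 3 := by
  calc (1 + δ) ^ n ≤ Real.exp δ ^ n := pow_le_pow_left₀ (by linarith) (by linarith [Real.add_one_le_exp δ]) n
    _ = Real.exp ((n : ℝ) * δ) := by rw [← Real.exp_nat_mul]
    _ ≤ Real.exp 1 := Real.exp_le_exp.mpr h
    _ ≤ 3 := by have := Real.exp_one_lt_d9; linarith

/-! ### Lemma 9.2 from Lemma 9.4: auxiliary steps with small contexts -/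

section Aux

/-- The twisted prime sums in the range of Lemma 9.2 from `GrossenCharPNT`: `u ≥ A₀ ≥ z₀`, `log u ≥ ℓ`,
`q ≤ ℓ^A ≤ (log u)^A`, `|j|, |k| < K₀ ≤ e^{c₉√ℓ} ≤ e^{c₉√(log u)}`. [cite: HeathBrownActa2001, Lemma 9.4] -/
theorem theta_bound_of_grossenCharPNT {A : ℕ} {c₉ C₉' C₉ z₀ : ℝ} (h94A : GrossenCharPNT A c₉ C₉' z₀) (hC₉' : C₉' ≤ C₉)
    (hc₉ : 0 ≤ c₉) {q : ℕ} (hq : 1 ≤ q) {ℓ A₀ : ℝ} {K₀ : ℕ} (hA₀pos : 0 < A₀) (hℓA₀ : ℓ ≤ Real.log A₀) (hℓ0 : 0 ≤ ℓ)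
    (hz₀ : z₀ ≤ A₀) (hqA : (q : ℝ) ≤ ℓ ^ A) (hK₀ : (K₀ : ℝ) ≤ Real.exp (c₉ * Real.sqrt ℓ)) :
    ∀ (ψ : MulChar (QuotMod q) ℂ) (j k : ℤ), j ∈ Finset.Ioo (-(K₀ : ℤ)) K₀ → k ∈ Finset.Ioo (-(K₀ : ℤ)) K₀ →
      ¬ IsTrivialMod q (grossenChar hq ψ j k) → ∀ u : ℝ, A₀ ≤ u →
        ‖grossenTheta (grossenChar hq ψ j k) u‖ ≤ C₉ * u * Real.exp (-(c₉ * Real.sqrt (Real.log u))) := by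
  intro ψ j k hj hk hnt u hu
  have hu0 : 0 < u := by linarith
  have hlogu : ℓ ≤ Real.log u := hℓA₀.trans (Real.log_le_log hA₀pos hu)
  have hqu : (q : ℝ) ≤ Real.log u ^ (A : ℝ) := by
    rw [Real.rpow_natCast]; exact hqA.trans (pow_le_pow_left₀ hℓ0 hlogu A)
  have hK₀u : (K₀ : ℝ) ≤ Real.exp (c₉ * Real.sqrt (Real.log u)) :=
    hK₀.trans (Real.exp_le_exp.mpr (mul_le_mul_of_nonneg_left (Real.sqrt_le_sqrt hlogu) hc₉))
  have hIoo : ∀ i : ℤ, i ∈ Finset.Ioo (-(K₀ : ℤ)) K₀ → |(i : ℝ)| ≤ (K₀ : ℝ) := by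
    intro i hi
    rw [Finset.mem_Ioo] at hi
    have h1 : ((-(K₀ : ℤ) : ℤ) : ℝ) < (i : ℝ) := Int.cast_lt.mpr hi.1
    have h2 : ((i : ℤ) : ℝ) < ((K₀ : ℤ) : ℝ) := Int.cast_lt.mpr hi.2
    have e : ((K₀ : ℤ) : ℝ) = (K₀ : ℝ) := Int.cast_natCast K₀
    rw [Int.cast_neg, e] at h1
    rw [e] at h2
    exact abs_le.mpr ⟨h1.le, h2.le⟩
  refine (h94A u (hz₀.trans hu) q hq hqu ψ j k ((hIoo j hj).trans hK₀u) ((hIoo k hk).trans hK₀u) hnt).trans ?_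
  have : 0 ≤ u * Real.exp (-(c₉ * Real.sqrt (Real.log u))) := by positivity
  calc C₉' * u * Real.exp (-(c₉ * Real.sqrt (Real.log u))) = C₉' * (u * Real.exp (-(c₉ * Real.sqrt (Real.log u)))) := by ring
    _ ≤ C₉ * (u * Real.exp (-(c₉ * Real.sqrt (Real.log u)))) := mul_le_mul_of_nonneg_right hC₉' this
    _ = _ := by ring

/-- `q ≤ ℓ^A`, `√ℓ ≥ 6A`, `ℓ > 1` give `q³ < e^{2ℓ} = X^τ`. [folklore] -/
theorem pow_three_lt_exp {q : ℕ} {ℓ t : ℝ} {A : ℕ} (hqA : (q : ℝ) ≤ ℓ ^ A) (htt : t ^ 2 = ℓ) (ht0 : 0 ≤ t)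
    (htA : 6 * (A : ℝ) ≤ t) (hℓ1 : 1 < ℓ) : (q : ℝ) ^ 3 < Real.exp (2 * ℓ) := by
  have hℓpos : 0 < ℓ := by linarith
  have hst : Real.sqrt ℓ = t := by rw [← htt, Real.sqrt_sq ht0]
  have hlogℓ : Real.log ℓ ≤ 2 * t := by have h := log_le_two_mul_sqrt hℓpos; rwa [hst] at h
  have hlog0 : 0 ≤ Real.log ℓ := Real.log_nonneg hℓ1.le
  have h1 : (q : ℝ) ^ 3 ≤ (ℓ ^ A) ^ 3 := pow_le_pow_left₀ (Nat.cast_nonneg _) hqA 3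
  have h2 : (ℓ ^ A) ^ 3 = Real.exp (3 * A * Real.log ℓ) := by
    rw [← pow_mul, ← Real.exp_log (pow_pos hℓpos _), Real.log_pow]; push_cast; ring_nf
  have hA0 : (0 : ℝ) ≤ A := Nat.cast_nonneg A
  have h3 : 3 * (A : ℝ) * Real.log ℓ < 2 * ℓ := by
    calc 3 * (A : ℝ) * Real.log ℓ ≤ 3 * A * (2 * t) := mul_le_mul_of_nonneg_left hlogℓ (by positivity)
      _ = (6 * A) * t := by ring
      _ ≤ t * t := mul_le_mul_of_nonneg_right htA ht0
      _ = ℓ := by rw [← sq, htt]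
      _ < 2 * ℓ := by linarith
  calc (q : ℝ) ^ 3 ≤ (ℓ ^ A) ^ 3 := h1
    _ = Real.exp (3 * A * Real.log ℓ) := h2
    _ < Real.exp (2 * ℓ) := Real.exp_lt_exp.mpr h3

/-- `18 log X/√A₀ ≤ e^{−c₉√ℓ}` (`A₀ = L²/2`, `L = e^ℓ`, `log log X ≤ ℓ/4`, `√ℓ ≥ 4c₉`, `ℓ ≥ 9`). [folklore] -/
theorem logX_div_sqrt_le {X L ℓ t c₉ : ℝ} (hlogX : 0 < Real.log X) (hMℓ : Real.log (Real.log X) ≤ ℓ / 4) (hLexp : L = Real.exp ℓ)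
    (htt : t ^ 2 = ℓ) (ht0 : 0 ≤ t) (ht4c9 : 4 * c₉ ≤ t) (hℓ9 : 9 ≤ ℓ) :
    12 * (3 / 2 * Real.log X) / Real.sqrt (L ^ 2 / 2) ≤ Real.exp (-(c₉ * t)) := by
  have hLpos : 0 < L := by rw [hLexp]; exact Real.exp_pos _
  have hsqrt : Real.sqrt (L ^ 2 / 2) = L / Real.sqrt 2 := by
    rw [Real.sqrt_div' _ (by norm_num : (0:ℝ) ≤ 2), Real.sqrt_sq hLpos.le]
  rw [hsqrt, div_div_eq_mul_div, div_le_iff₀ hLpos, hLexp]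
  have hlogXexp : Real.log X ≤ Real.exp (ℓ / 4) := by
    calc Real.log X = Real.exp (Real.log (Real.log X)) := (Real.exp_log hlogX).symm
      _ ≤ Real.exp (ℓ / 4) := Real.exp_le_exp.mpr hMℓ
  have hc9t : c₉ * t ≤ ℓ / 4 := by
    have : c₉ * t ≤ (t / 4) * t := mul_le_mul_of_nonneg_right (by linarith) ht0
    rw [← htt]; linarith
  have hkey : Real.exp (ℓ / 4) * Real.exp (ℓ / 2) ≤ Real.exp (-(c₉ * t)) * Real.exp ℓ := by
    rw [← Real.exp_add, ← Real.exp_add]; exact Real.exp_le_exp.mpr (by linarith)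
  have h26 : (26 : ℝ) < Real.exp (ℓ / 2) := exp_four_gt.trans_le (Real.exp_le_exp.mpr (by linarith))
  have hs2 : Real.sqrt 2 < 1.42 := by rw [Real.sqrt_lt' (by norm_num)]; norm_num
  have hs0 := Real.sqrt_nonneg 2
  have he4 := Real.exp_pos (ℓ / 4)
  calc 12 * (3 / 2 * Real.log X) * Real.sqrt 2 = (18 * Real.sqrt 2) * Real.log X := by ring
    _ ≤ 26 * Real.exp (ℓ / 4) := mul_le_mul (by linarith) hlogXexp hlogX.le (by norm_num)
    _ ≤ Real.exp (ℓ / 2) * Real.exp (ℓ / 4) := mul_le_mul_of_nonneg_right h26.le he4.le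
    _ = Real.exp (ℓ / 4) * Real.exp (ℓ / 2) := mul_comm _ _
    _ ≤ Real.exp (-(c₉ * t)) * Real.exp ℓ := hkey

/-- `(1 + δ)^n ≤ 3` for `δ = C_θe^{−c_θ√(τ log X)} + (8 + 2C_θ)/(ξ log X)`, `n ≤ 3/(2τ)`, in the range of Lemma 9.2. [folklore] -/
theorem one_add_delta_pow_le_three {n : ℕ} {τ t ℓ X Cθ cθ : ℝ} (hτpos : 0 < τ) (hCθ : 0 ≤ Cθ) (hcθ : 0 < cθ)
    (hlogX : 0 < Real.log X) (hτlogX : τ * Real.log X = 2 * ℓ) (htt : t ^ 2 = ℓ) (ht0 : 0 ≤ t)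
    (hnτ : (n : ℝ) ≤ 3 / (2 * τ)) (hτe : 1 / τ ≤ Real.exp (cθ / 2 * t)) (htθ : 2 / cθ * Real.log (3 * Cθ + 1) ≤ t)
    (hB : 3 * (8 + 2 * Cθ) ≤ τ ^ 6 * Real.log X) :
    (1 + (Cθ * Real.exp (-cθ * Real.sqrt (τ * Real.log X)) + (8 + 2 * Cθ) / (hbXi τ * Real.log X))) ^ n ≤ 3 := by
  have hξ := hbXi_pos hτpos
  have hδ0 : 0 ≤ Cθ * Real.exp (-cθ * Real.sqrt (τ * Real.log X)) + (8 + 2 * Cθ) / (hbXi τ * Real.log X) := by positivity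
  refine one_add_pow_le_three hδ0 ?_
  have hℓ0 : 0 ≤ ℓ := by rw [← htt]; positivity
  have hexpθ : Real.exp (-cθ * Real.sqrt (τ * Real.log X)) ≤ Real.exp (-(cθ * t)) := by
    rw [hτlogX]; apply Real.exp_le_exp.mpr
    have h1 : t ≤ Real.sqrt (2 * ℓ) := by
      rw [← Real.sqrt_sq ht0, htt]; exact Real.sqrt_le_sqrt (by linarith)
    have := mul_le_mul_of_nonneg_left h1 hcθ.le
    linarith
  -- first part
  have hA' : 3 / (2 * τ) * (Cθ * Real.exp (-(cθ * t))) ≤ 1 / 2 := by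
    have h3 : 3 * Cθ + 1 ≤ Real.exp (cθ / 2 * t) := by
      have : Real.log (3 * Cθ + 1) ≤ cθ / 2 * t := by
        have h' : 2 * Real.log (3 * Cθ + 1) ≤ t * cθ := by
          rw [div_mul_eq_mul_div, div_le_iff₀ hcθ] at htθ; exact htθ
        linarith only [h']
      calc 3 * Cθ + 1 = Real.exp (Real.log (3 * Cθ + 1)) := (Real.exp_log (by linarith)).symm
        _ ≤ Real.exp (cθ / 2 * t) := Real.exp_le_exp.mpr this
    have hE : Real.exp (cθ / 2 * t) * Real.exp (-(cθ * t)) = (Real.exp (cθ / 2 * t))⁻¹ := by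
      rw [← Real.exp_add, ← Real.exp_neg]; congr 1; ring
    have hpos : 0 < Real.exp (cθ / 2 * t) := Real.exp_pos _
    calc 3 / (2 * τ) * (Cθ * Real.exp (-(cθ * t))) = 3 / 2 * Cθ * (1 / τ * Real.exp (-(cθ * t))) := by field_simp
      _ ≤ 3 / 2 * Cθ * (Real.exp (cθ / 2 * t) * Real.exp (-(cθ * t))) := by
          apply mul_le_mul_of_nonneg_left _ (by positivity)
          exact mul_le_mul_of_nonneg_right hτe (Real.exp_pos _).le
      _ = 3 / 2 * Cθ / Real.exp (cθ / 2 * t) := by rw [hE]; ring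
      _ ≤ 1 / 2 := by rw [div_le_iff₀ hpos]; linarith
  -- second part
  have hB' : 3 / (2 * τ) * ((8 + 2 * Cθ) / (hbXi τ * Real.log X)) ≤ 1 / 2 := by
    rw [hbXi]
    have hτ6pos : 0 < τ ^ 6 * Real.log X := by positivity
    have : 3 / (2 * τ) * ((8 + 2 * Cθ) / (τ ^ 5 * Real.log X)) = 3 * (8 + 2 * Cθ) / 2 / (τ ^ 6 * Real.log X) := by
      rw [div_mul_div_comm, div_div]; congr 1; ring
    rw [this, div_le_iff₀ hτ6pos]
    linarith
  calc (n : ℝ) * (Cθ * Real.exp (-cθ * Real.sqrt (τ * Real.log X)) + (8 + 2 * Cθ) / (hbXi τ * Real.log X))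
      ≤ 3 / (2 * τ) * (Cθ * Real.exp (-(cθ * t)) + (8 + 2 * Cθ) / (hbXi τ * Real.log X)) := by
        apply mul_le_mul hnτ _ hδ0 (by positivity)
        have := mul_le_mul_of_nonneg_left hexpθ hCθ
        linarith
    _ = 3 / (2 * τ) * (Cθ * Real.exp (-(cθ * t))) + 3 / (2 * τ) * ((8 + 2 * Cθ) / (hbXi τ * Real.log X)) := by ring
    _ ≤ 1 := by linarith

/-- `(1 + c₁/(ξ log X))^n ≤ 3` for `n ≤ 3/(2τ)`, `τ⁶ log X ≥ 3c₁`. [folklore] -/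
theorem one_add_c1_pow_le_three {n : ℕ} {τ X c₁ : ℝ} (hτpos : 0 < τ) (hlogX : 0 < Real.log X) (hc₁ : 0 ≤ c₁)
    (hnτ : (n : ℝ) ≤ 3 / (2 * τ)) (hB : 3 * c₁ ≤ τ ^ 6 * Real.log X) : (1 + c₁ / (hbXi τ * Real.log X)) ^ n ≤ 3 := by
  have hξ := hbXi_pos hτpos
  refine one_add_pow_le_three (by positivity) ?_
  rw [hbXi]
  have hτ6pos : 0 < τ ^ 6 * Real.log X := by positivity
  calc (n : ℝ) * (c₁ / (τ ^ 5 * Real.log X)) ≤ 3 / (2 * τ) * (c₁ / (τ ^ 5 * Real.log X)) :=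
        mul_le_mul_of_nonneg_right hnτ (by positivity)
    _ = 3 * c₁ / 2 / (τ ^ 6 * Real.log X) := by rw [div_mul_div_comm, div_div]; congr 1; ring
    _ ≤ 1 := by rw [div_le_iff₀ hτ6pos]; linarith

/-- `1/Δ/√K₀ ≤ √2Δ⁻¹e^{−(c₉/2)t}` and `≤ 1` for `K₀ = ⌊e^{c₉t}⌋`, `c₉t ≥ 2`, `Δ⁻¹ = e^{c_Δt}`, `c_Δ ≤ c₉/20`. [folklore] -/
theorem eps_bounds {Δ t c₉ cΔ : ℝ} {K₀ : ℕ} (hΔpos : 0 < Δ) (hΔinv : Δ⁻¹ = Real.exp (cΔ * t)) (ht0 : 0 ≤ t)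
    (hK₀ : K₀ = ⌊Real.exp (c₉ * t)⌋₊) (hc9t : 2 ≤ c₉ * t) (hcΔ : cΔ ≤ c₉ / 20) :
    1 / Δ / Real.sqrt K₀ ≤ Real.sqrt 2 * Δ⁻¹ * Real.exp (-(c₉ / 2 * t)) ∧ 1 / Δ / Real.sqrt K₀ ≤ 1 ∧ 1 ≤ K₀ ∧
      (K₀ : ℝ) ≤ Real.exp (c₉ * t) := by
  set y : ℝ := Real.exp (c₉ * t) with hy
  have hy2 : 2 ≤ y := by have := Real.add_one_le_exp (c₉ * t); rw [hy]; linarith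
  have hK₀y : (K₀ : ℝ) ≤ y := by rw [hK₀]; exact Nat.floor_le (by linarith)
  have hK₀half : y / 2 ≤ K₀ := by have := Nat.lt_floor_add_one y; rw [← hK₀] at this; linarith
  have hK : 1 ≤ K₀ := by rw [hK₀]; exact Nat.le_floor (by norm_num; linarith)
  have hsqy : Real.sqrt (y / 2) = Real.exp (c₉ / 2 * t) / Real.sqrt 2 := by
    rw [Real.sqrt_div' _ (by norm_num : (0:ℝ) ≤ 2)]
    congr 1
    have : Real.exp (c₉ / 2 * t) ^ 2 = y := by rw [hy, sq, ← Real.exp_add]; ring_nf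
    rw [← this, Real.sqrt_sq (Real.exp_pos _).le]
  have hε' : 1 / Δ / Real.sqrt K₀ ≤ Real.sqrt 2 * Δ⁻¹ * Real.exp (-(c₉ / 2 * t)) := by
    have h1 : Real.sqrt (y / 2) ≤ Real.sqrt K₀ := Real.sqrt_le_sqrt hK₀half
    have h2 : 0 < Real.sqrt (y / 2) := Real.sqrt_pos.mpr (by linarith)
    calc 1 / Δ / Real.sqrt K₀ = Δ⁻¹ * (1 / Real.sqrt K₀) := by ring
      _ ≤ Δ⁻¹ * (1 / Real.sqrt (y / 2)) := by
          apply mul_le_mul_of_nonneg_left _ (inv_nonneg.mpr hΔpos.le)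
          exact one_div_le_one_div_of_le h2 h1
      _ = Real.sqrt 2 * Δ⁻¹ * Real.exp (-(c₉ / 2 * t)) := by
          rw [hsqy, Real.exp_neg]; field_simp
  refine ⟨hε', hε'.trans ?_, hK, hK₀y⟩
  rw [hΔinv, mul_assoc, ← Real.exp_add]
  have hexp : Real.exp (cΔ * t + -(c₉ / 2 * t)) ≤ Real.exp (-(9 / 10)) := by
    apply Real.exp_le_exp.mpr
    have h3 : cΔ * t ≤ c₉ / 20 * t := mul_le_mul_of_nonneg_right hcΔ ht0
    linarith
  have hexp2 : Real.exp (-(9 / 10 : ℝ)) ≤ 10 / 19 := by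
    have h19 : (19 / 10 : ℝ) ≤ Real.exp (9 / 10) := by have := Real.add_one_le_exp (9 / 10 : ℝ); linarith
    rw [Real.exp_neg, inv_le_comm₀ (Real.exp_pos _) (by norm_num)]
    calc (10 / 19 : ℝ)⁻¹ = 19 / 10 := by norm_num
      _ ≤ Real.exp (9 / 10) := h19
  have hs2 := Real.sqrt_two_lt_three_halves
  calc Real.sqrt 2 * Real.exp (cΔ * t + -(c₉ / 2 * t)) ≤ 3 / 2 * (10 / 19) :=
      mul_le_mul hs2.le (hexp.trans hexp2) (Real.exp_pos _).le (by norm_num)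
    _ ≤ 1 := by norm_num

end Aux

/-! ### Lemma 9.2 from Lemma 9.4 -/

set_option maxHeartbeats 4000000 in
/-- **Lemma 9.2 from Lemma 9.4** (pp. 52–60 of the paper, assembled): the Siegel–Walfisz theorem for the weights
`d_S` in cubes (the hypothesis `h92` of `HeathBrown2001_lemma_3_8_of_lemma92`, verbatim) follows from the prime number
theorem for the Hecke characters `ν^{(j,k)}χ` of `K = ℚ(2^{1/3})`, uniform in the stated ranges — Lemma 9.4 of the paper
(Mitsui [19]), in the form `∀ A > 0, ∃ c > 0, C, z₀, GrossenCharPNT A c C z₀` of `HeathBrownCubicGrossenPrimeSums` — with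
`Δ = exp{−(min(c, c₂)/20)√(log L)}` in place of the paper's `exp{−(c/6)√(log L)}` (the constants of Lemma 4.10 and of
the lattice-point counts are tracked explicitly here). [cite: HeathBrownActa2001, Lemma 9.2 and §9 pp. 52–60; Lemma 9.4] -/
theorem HeathBrown2001_lemma_9_2_of_lemma94
    (h94 : ∀ A : ℝ, 0 < A → ∃ c C z₀ : ℝ, 0 < c ∧ GrossenCharPNT A c C z₀) :
    ∀ ϖ : ℝ, 0 < ϖ → ϖ < 1 / 5 → ∀ A : ℕ, 0 < A → ∀ c₃ c₄ : ℝ, 0 < c₃ → 0 < c₄ →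
      ∃ C c X₀ : ℝ, 0 < c ∧ ∀ X : ℝ, X₀ ≤ X → ∀ (k : ℕ) (m : Fin k → ℕ),
        CoreAdmissible (hbTau ϖ X) m →
          ∀ q : ℕ, 1 ≤ q → (q : ℝ) ≤ Real.log (hbL X (hbTau ϖ X)) ^ A →
            ∀ α : 𝓞 K, IsCoprime α (q : 𝓞 K) →
              ∀ (V : ℝ) (a : ℝ × ℝ × ℝ) (S₀ : ℝ), 0 < V →
                hbL X (hbTau ϖ X) ^ 2 ≤ S₀ → CubeCond c₃ c₄ V a S₀ →
                  |cubeClassSum (dWeight X (hbTau ϖ X) m) q α a S₀ -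
                      swMainTerm X (hbTau ϖ X) m q a S₀| ≤
                    C * V * Real.exp (-(c * Real.sqrt (Real.log (hbL X (hbTau ϖ X))))) := by
  intro ϖ hϖ0 _hϖ5 A hA c₃ c₄ hc₃ hc₄
  -- constants
  obtain ⟨C₀, hC₀, h95⟩ := exists_lemma95Bound
  obtain ⟨c₁, c₂, C₄, hc₁, hc₂, hC₄, h410⟩ := exists_tupleCountBound
  obtain ⟨cθ, hcθ, Cθ', hθ₁'⟩ := abs_degreeOneTheta_sub_self_le K
  obtain ⟨c₉, C₉', z₀, hc₉, h94A⟩ := h94 A (by exact_mod_cast hA)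
  set Cθ : ℝ := max Cθ' 0 with hCθdef
  have hCθ : 0 ≤ Cθ := le_max_right _ _
  have hCθ' : Cθ' ≤ Cθ := le_max_left _ _
  clear_value Cθ
  have hθ₁ : ∀ x : ℝ, 2 ≤ x → |degreeOneTheta K x - x| ≤ Cθ * x * Real.exp (-cθ * Real.sqrt (Real.log x)) := by
    intro x hx
    refine (hθ₁' x hx).trans ?_
    have : 0 ≤ x * Real.exp (-cθ * Real.sqrt (Real.log x)) := by positivity
    calc Cθ' * x * Real.exp (-cθ * Real.sqrt (Real.log x)) = Cθ' * (x * Real.exp (-cθ * Real.sqrt (Real.log x))) := by ring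
      _ ≤ Cθ * (x * Real.exp (-cθ * Real.sqrt (Real.log x))) := mul_le_mul_of_nonneg_right hCθ' this
      _ = _ := by ring
  set C₉ : ℝ := max C₉' 0 with hC₉def
  have hC₉ : 0 ≤ C₉ := le_max_right _ _
  have hC₉' : C₉' ≤ C₉ := le_max_left _ _
  clear_value C₉
  set cm : ℝ := min c₉ c₂ with hcm
  have hcm0 : 0 < cm := lt_min hc₉ hc₂
  have hcm9 : cm ≤ c₉ := min_le_left _ _
  have hcm2 : cm ≤ c₂ := min_le_right _ _
  clear_value cm
  set cΔ : ℝ := cm / 20 with hcΔ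
  have hcΔ0 : 0 < cΔ := by rw [hcΔ]; positivity
  clear_value cΔ
  set ce : ℝ := min (cm / 4) (cθ / 2) with hce
  have hce0 : 0 < ce := lt_min (by positivity) (by positivity)
  have hce1 : ce ≤ cm / 4 := min_le_left _ _
  have hce2 : ce ≤ cθ / 2 := min_le_right _ _
  clear_value ce
  set κ : ℝ := C₀ * (1 + 1 / c₄) with hκdef
  have hκ0 : 0 ≤ κ := by rw [hκdef]; positivity
  set dmin : ℝ := min (min (1 / 16) (c₄ / 4)) (1 / (2 * κ + 1)) with hdmin
  have hdmin0 : 0 < dmin := lt_min (lt_min (by norm_num) (by positivity)) (by positivity)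
  have hdmin16 : dmin ≤ 1 / 16 := (min_le_left _ _).trans (min_le_left _ _)
  have hdminc : dmin ≤ c₄ / 4 := (min_le_left _ _).trans (min_le_right _ _)
  have hdminκ : dmin ≤ 1 / (2 * κ + 1) := min_le_right _ _
  have hlogd : 0 ≤ Real.log (1 / dmin) := Real.log_nonneg (by rw [le_div_iff₀ hdmin0]; linarith)
  clear_value dmin
  set T₀ : ℝ := 3 + 6 * A + 2 / c₉ + 4 * c₉ + Real.sqrt (Real.log (2 * |z₀| + 2)) + Real.log (1 / dmin) / cΔ + cΔ +
    2 / cθ * Real.log (3 * Cθ + 1) with hT₀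
  set Bτ : ℝ := 3 * (8 + 2 * Cθ) + 3 * c₁ + 1 with hBτ
  obtain ⟨X₀, hX₀⟩ := Filter.eventually_atTop.mp (eventually_lemma92_params hϖ0 T₀ Bτ hce0)
  set Ctot : ℝ := (16 * Real.pi * (5 + 3 * (2 * C₀ * (1 + 1 / c₄))) ^ 3 +
          64 * (5 + 2 * (C₀ * (1 + 2 / c₄) * (5 + 2 * (2 * C₀ * (1 + 1 / c₄))))) ^ 2 *
            (2 * (C₀ * (1 + 2 / c₄) * (5 + 2 * (2 * C₀ * (1 + 1 / c₄)))) + 4)) * c₃ ^ 3 +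
        704 * c₃ ^ 3 / (c₄ * gamma₀) +
        64 * c₃ ^ 3 / gamma₀ * (3 * Real.sqrt 2 + 3 * Real.sqrt 2 * (9 * C₄ * (13 * c₃ ^ 3 + 1)) +
          5 * (3 * (2 * C₉ + 1) * (13 * c₃ ^ 3 + 1)) + 9 * C₄ * (13 * c₃ ^ 3 + 1)) with hCtot
  clear_value Ctot
  refine ⟨Ctot, cΔ, X₀, hcΔ0, ?_⟩
  intro X hXX₀ k m hm q hq hqA α hα V a S₀ hV hS₀L hcube
  obtain ⟨hX2, hτpos, hτ4, hT, hξ1, hB, hτinv, hMℓ⟩ := hX₀ X hXX₀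
  set τ := hbTau ϖ X with hτdef
  clear_value τ
  have hτ1 : τ ≤ 1 := by linarith
  have hξ := hbXi_pos hτpos
  -- `k = 0` is excluded by (3.6)
  cases k with
  | zero =>
    exfalso
    have h := hm.2.2.1
    simp only [Finset.univ_eq_empty, Finset.sum_empty] at h
    have : 0 < (1 + τ) / hbXi τ := by positivity
    linarith
  | succ n =>
  have hX1 : 1 < X := by linarith
  have hX0 : 0 < X := by linarith
  have hlogX : 0 < Real.log X := Real.log_pos hX1
  set L := hbL X τ with hLdef
  have hLpos : 0 < L := by rw [hLdef]; exact hbL_pos hX0 τ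
  set ℓ := Real.log L with hℓdef
  have hℓ : ℓ = τ / 2 * Real.log X := by rw [hℓdef, hLdef, hbL, Real.log_rpow hX0]
  have hℓ0 : 0 ≤ ℓ := by rw [hℓ]; positivity
  set t := Real.sqrt ℓ with htdef
  have ht0 : 0 ≤ t := by rw [htdef]; exact Real.sqrt_nonneg _
  have htt : t ^ 2 = ℓ := by rw [htdef]; exact Real.sq_sqrt hℓ0
  have hXτ : X ^ τ = L ^ 2 := by
    rw [hLdef, hbL, ← Real.rpow_natCast, ← Real.rpow_mul hX0.le]; norm_num
  have hLexp : L = Real.exp ℓ := by rw [hℓdef, Real.exp_log hLpos]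
  clear_value t ℓ L
  -- the thresholds
  have hsq0 : 0 ≤ Real.sqrt (Real.log (2 * |z₀| + 2)) := Real.sqrt_nonneg _
  have hlog3 : 0 ≤ 2 / cθ * Real.log (3 * Cθ + 1) := by
    have : 0 ≤ Real.log (3 * Cθ + 1) := Real.log_nonneg (by linarith); positivity
  have hA0 : (0 : ℝ) ≤ 6 * A := by positivity
  have h2c9 : 0 ≤ 2 / c₉ := by positivity
  have h4c9 : 0 ≤ 4 * c₉ := by positivity
  have hldc : 0 ≤ Real.log (1 / dmin) / cΔ := by positivity
  rw [hT₀] at hT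
  have ht3 : 3 ≤ t := by linarith
  have htA : 6 * (A : ℝ) ≤ t := by linarith
  have ht2c9 : 2 / c₉ ≤ t := by linarith
  have ht4c9 : 4 * c₉ ≤ t := by linarith
  have htz : Real.sqrt (Real.log (2 * |z₀| + 2)) ≤ t := by linarith
  have htd : Real.log (1 / dmin) / cΔ ≤ t := by linarith
  have htcΔ : cΔ ≤ t := by linarith
  have htθ : 2 / cθ * Real.log (3 * Cθ + 1) ≤ t := by linarith
  clear hT
  have hℓ9 : 9 ≤ ℓ := by nlinarith
  have hℓpos : 0 < ℓ := by linarith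
  have hXτexp : X ^ τ = Real.exp (2 * ℓ) := by rw [hXτ, hLexp, ← Real.exp_nat_mul]; norm_num
  have hXτ19 : 19 ≤ X ^ τ := by
    rw [hXτexp]; have := Real.add_one_le_exp (2 * ℓ); linarith
  have h3 : 3 ≤ X ^ τ := by linarith
  have hτlogX : τ * Real.log X = 2 * ℓ := by rw [hℓ]; ring
  -- `Δ`
  set Δ : ℝ := Real.exp (-(cΔ * t)) with hΔdef
  have hΔpos : 0 < Δ := by rw [hΔdef]; exact Real.exp_pos _
  clear_value Δ
  have hΔ1 : Δ ≤ 1 := by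
    rw [hΔdef]; apply Real.exp_le_one_iff.mpr
    have : 0 ≤ cΔ * t := by positivity
    linarith
  have hΔinv : Δ⁻¹ = Real.exp (cΔ * t) := by rw [hΔdef, Real.exp_neg, inv_inv]
  have hΔd : Δ ≤ dmin := by
    have h1 : Real.log (1 / dmin) ≤ cΔ * t := by rw [div_le_iff₀ hcΔ0] at htd; linarith
    calc Δ = Real.exp (-(cΔ * t)) := hΔdef
      _ ≤ Real.exp (-Real.log (1 / dmin)) := Real.exp_le_exp.mpr (by linarith)
      _ = dmin := by rw [Real.log_div one_ne_zero hdmin0.ne', Real.log_one, zero_sub, neg_neg, Real.exp_log hdmin0]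
  have hΔ16 : Δ ≤ 1 / 16 := hΔd.trans hdmin16
  have hΔc : Δ ≤ c₄ / 4 := hΔd.trans hdminc
  have hκΔ : C₀ * (1 + 1 / c₄) * Δ ≤ 1 / 2 := by
    rw [← hκdef]
    have h1 : Δ ≤ 1 / (2 * κ + 1) := hΔd.trans hdminκ
    calc κ * Δ ≤ κ * (1 / (2 * κ + 1)) := mul_le_mul_of_nonneg_left h1 hκ0
      _ ≤ 1 / 2 := by rw [mul_one_div, div_le_iff₀ (by positivity)]; linarith
  -- `K₀`, `ε`
  set K₀ : ℕ := ⌊Real.exp (c₉ * t)⌋₊ with hK₀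
  clear_value K₀
  have hc9t : 2 ≤ c₉ * t := by rw [div_le_iff₀ hc₉] at ht2c9; linarith
  obtain ⟨hε', hε, hK, hK₀y⟩ := eps_bounds hΔpos hΔinv ht0 hK₀ hc9t (by rw [hcΔ]; linarith)
  -- `A₀`
  set A₀ : ℝ := X ^ τ / 2 with hA₀def
  clear_value A₀
  have hA₀1 : 1 ≤ A₀ := by rw [hA₀def]; linarith
  have hA₀X : A₀ + 1 ≤ X ^ τ := by rw [hA₀def]; linarith
  have hA₀pos : 0 < A₀ := by linarith
  have hlogA₀ : Real.log A₀ = 2 * ℓ - Real.log 2 := by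
    rw [hA₀def, Real.log_div (by positivity) (by norm_num), hXτexp, Real.log_exp]
  have hlog2 : Real.log 2 < 1 := by
    have := Real.exp_one_gt_d9
    rw [Real.log_lt_iff_lt_exp (by norm_num)]; linarith
  have hℓA₀ : ℓ ≤ Real.log A₀ := by rw [hlogA₀]; linarith
  -- `z₀ ≤ A₀`
  have hL1 : 1 ≤ L := by rw [hLexp]; exact Real.one_le_exp hℓ0
  have hz₀ : z₀ ≤ A₀ := by
    have hl0 : 0 ≤ Real.log (2 * |z₀| + 2) := Real.log_nonneg (by linarith [abs_nonneg z₀])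
    have h1 : Real.log (2 * |z₀| + 2) ≤ ℓ := by
      have h' : Real.sqrt (Real.log (2 * |z₀| + 2)) ^ 2 ≤ t ^ 2 := pow_le_pow_left₀ hsq0 htz 2
      rwa [htt, Real.sq_sqrt hl0] at h'
    have h2 : 2 * |z₀| + 2 ≤ L := by
      rw [hLexp]
      calc 2 * |z₀| + 2 = Real.exp (Real.log (2 * |z₀| + 2)) := (Real.exp_log (by linarith [abs_nonneg z₀])).symm
        _ ≤ Real.exp ℓ := Real.exp_le_exp.mpr h1
    have hLL : L ≤ L ^ 2 := by
      calc L = L * 1 := (mul_one L).symm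
        _ ≤ L * L := mul_le_mul_of_nonneg_left hL1 (zero_le_one.trans hL1)
        _ = L ^ 2 := (sq L).symm
    calc z₀ ≤ |z₀| := le_abs_self _
      _ ≤ L / 2 := by linarith only [h2, abs_nonneg z₀]
      _ ≤ L ^ 2 / 2 := by linarith only [hLL]
      _ = A₀ := by rw [hA₀def, hXτ]
  -- the twisted prime sums
  have hθ := theta_bound_of_grossenCharPNT h94A hC₉' hc₉.le hq hA₀pos hℓA₀ hℓ0 hz₀ hqA (by rw [← htdef]; exact hK₀y)
  -- `q³ < X^τ`
  have hqX : (q : ℝ) ^ 3 < X ^ τ := by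
    rw [hXτexp]; exact pow_three_lt_exp hqA htt ht0 htA (by linarith)
  -- the cube
  have hS₀pos : 0 < S₀ := lt_of_lt_of_le (by positivity) hS₀L
  obtain ⟨-, hS₀4⟩ := corner_bounds hS₀pos hcube
  have hsV : (c₃ * V ^ (1 / 3 : ℝ)) ^ 3 = c₃ ^ 3 * V := by
    rw [mul_pow, ← Real.rpow_natCast (V ^ (1 / 3 : ℝ)) 3, ← Real.rpow_mul hV.le]; norm_num
  set s : ℝ := c₃ * V ^ (1 / 3 : ℝ) with hs
  clear_value s
  have hs0 : 0 < s := by rw [hs]; positivity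
  have hL24 : 4 ≤ L ^ 2 := by rw [← hXτ]; linarith
  have hs1 : 1 ≤ s := by linarith
  have hsΔ : s ^ 2 ≤ 4 * c₃ ^ 3 * V * Δ := by
    rw [show 4 * c₃ ^ 3 * V * Δ = 4 * s ^ 3 * Δ by rw [hsV]; ring]
    have h1 : 1 ≤ L ^ 2 * Δ := by
      rw [← hXτ, hXτexp, hΔdef, ← Real.exp_add]
      apply Real.one_le_exp
      have : cΔ * t ≤ t * t := mul_le_mul_of_nonneg_right htcΔ ht0
      nlinarith only [this, htt]
    have h2 : L ^ 2 * Δ ≤ 4 * s * Δ := mul_le_mul_of_nonneg_right (by linarith) hΔpos.le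
    nlinarith only [h1, h2, hs0, hΔpos]
  have hM : 1 ≤ ∏ i, (m i : ℝ) := one_le_prod_of_coreAdmissible hτpos hτ1 hm
  -- `n + 1 ≤ 3/(2τ)`
  have hn : (n : ℝ) + 1 ≤ 3 / (2 * τ) := by
    have h := card_mul_lt_of_coreAdmissible hτpos hm
    push_cast at h
    rw [le_div_iff₀ (by positivity)]; nlinarith only [h, hτpos]
  have hnτ : (n : ℝ) ≤ 3 / (2 * τ) := by linarith
  -- `f₉`, `e₂`, `g`
  set f₉ : ℝ := Real.exp (-(c₉ * t)) with hf₉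
  set e₂ : ℝ := Real.exp (-(c₂ * t)) with he₂
  set g : ℝ := Real.exp (-(c₉ / 2 * t)) with hg
  have hf₉0 : 0 ≤ f₉ := by rw [hf₉]; exact (Real.exp_pos _).le
  have he₂0 : 0 ≤ e₂ := by rw [he₂]; exact (Real.exp_pos _).le
  have he₉ : Real.exp (-(c₉ * Real.sqrt (Real.log A₀))) ≤ f₉ := by
    rw [hf₉]; apply Real.exp_le_exp.mpr
    have h1 : t ≤ Real.sqrt (Real.log A₀) := by rw [htdef]; exact Real.sqrt_le_sqrt hℓA₀
    have := mul_le_mul_of_nonneg_left h1 hc₉.le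
    linarith
  have he₂' : Real.exp (-c₂ * Real.sqrt (τ * Real.log X)) ≤ e₂ := by
    rw [he₂, hτlogX]; apply Real.exp_le_exp.mpr
    have h1 : t ≤ Real.sqrt (2 * ℓ) := by rw [htdef]; exact Real.sqrt_le_sqrt (by linarith)
    have := mul_le_mul_of_nonneg_left h1 hc₂.le
    linarith
  have hlog : 12 * (3 / 2 * Real.log X) / Real.sqrt A₀ ≤ f₉ := by
    rw [hA₀def, hXτ, hf₉]; exact logX_div_sqrt_le hlogX hMℓ hLexp htt ht0 ht4c9 hℓ9
  have hτe : 1 / τ ≤ Real.exp (cθ / 2 * t) := hτinv.trans (Real.exp_le_exp.mpr (mul_le_mul_of_nonneg_right hce2 ht0))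
  rw [hBτ] at hB
  have hδ := one_add_delta_pow_le_three (n := n) hτpos hCθ hcθ hlogX hτlogX htt ht0 hnτ hτe htθ (by linarith)
  have hpow := one_add_c1_pow_le_three (n := n) hτpos hlogX hc₁ hnτ (by linarith)
  -- the four exponent products
  have hτcm : 1 / τ ≤ Real.exp (cm / 4 * t) := hτinv.trans (Real.exp_le_exp.mpr (mul_le_mul_of_nonneg_right hce1 ht0))
  have hcΔcm : cΔ = cm / 20 := hcΔ
  have hx1 : Δ⁻¹ ^ 3 * g ≤ Δ := by
    rw [hΔinv, hg, hΔdef, ← Real.exp_nat_mul, ← Real.exp_add]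
    apply Real.exp_le_exp.mpr; push_cast
    have : (4 * cΔ - c₉ / 2) * t ≤ 0 := mul_nonpos_of_nonpos_of_nonneg (by linarith) ht0
    linarith
  have hx3 : Δ⁻¹ ^ 5 * f₉ ≤ Δ := by
    rw [hΔinv, hf₉, hΔdef, ← Real.exp_nat_mul, ← Real.exp_add]
    apply Real.exp_le_exp.mpr; push_cast
    have : (6 * cΔ - c₉) * t ≤ 0 := mul_nonpos_of_nonpos_of_nonneg (by linarith) ht0
    linarith
  have he₂τ : e₂ / τ ≤ Real.exp (-(c₂ * t)) * Real.exp (cm / 4 * t) := by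
    rw [div_eq_mul_one_div, he₂]; exact mul_le_mul_of_nonneg_left hτcm (Real.exp_pos _).le
  have hx2 : Δ⁻¹ ^ 4 * g * (e₂ / τ) ≤ Δ := by
    calc Δ⁻¹ ^ 4 * g * (e₂ / τ) ≤ Δ⁻¹ ^ 4 * g * (Real.exp (-(c₂ * t)) * Real.exp (cm / 4 * t)) :=
          mul_le_mul_of_nonneg_left he₂τ (by rw [hg]; positivity)
      _ ≤ Δ := by
          rw [hΔinv, hg, hΔdef, ← Real.exp_nat_mul, ← Real.exp_add, ← Real.exp_add, ← Real.exp_add]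
          apply Real.exp_le_exp.mpr; push_cast
          have : (5 * cΔ + cm / 4 - c₉ / 2 - c₂) * t ≤ 0 := mul_nonpos_of_nonpos_of_nonneg (by linarith) ht0
          linarith
  have hx4 : Δ⁻¹ * (e₂ / τ) ≤ Δ := by
    calc Δ⁻¹ * (e₂ / τ) ≤ Δ⁻¹ * (Real.exp (-(c₂ * t)) * Real.exp (cm / 4 * t)) :=
          mul_le_mul_of_nonneg_left he₂τ (inv_nonneg.mpr hΔpos.le)
      _ ≤ Δ := by
          rw [hΔinv, hΔdef, ← Real.exp_add, ← Real.exp_add]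
          apply Real.exp_le_exp.mpr
          have : (2 * cΔ + cm / 4 - c₂) * t ≤ 0 := mul_nonpos_of_nonpos_of_nonneg (by linarith) ht0
          linarith
  -- assemble
  have hmain := abs_cubeClassSum_sub_swMainTerm_le_bound h95 hC₀ h410 hc₁ hC₄ hcθ.le hCθ hθ₁ hX1 hτpos hτ1 h3 hm hq hqX
    hK hA₀1 hA₀X hc₉.le hC₉ hθ hc₃ hc₄ hV hS₀pos hcube hΔpos hΔ16 hΔc hκΔ hε hα
  have hS₀4' : S₀ ≤ 4 * (c₃ * V ^ (1 / 3 : ℝ)) := by rw [← hs]; exact hS₀4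
  have hs1' : 1 ≤ c₃ * V ^ (1 / 3 : ℝ) := by rw [← hs]; exact hs1
  have hsΔ' : (c₃ * V ^ (1 / 3 : ℝ)) ^ 2 ≤ 4 * c₃ ^ 3 * V * Δ := by rw [← hs]; exact hsΔ
  have hbound := lemma92Bound_le (m := m) (K₀ := K₀) (A₀ := A₀) (C₉ := C₉) (c₉ := c₉) (Cθ := Cθ) (cθ := cθ)
    (c₁ := c₁) (c₂ := c₂) (C₄ := C₄) (f₉ := f₉) (e₂ := e₂) (g := g) (E := Δ)
    hτpos hX1 hξ1 hM hc₃ hc₄ hC₀.le hV hΔpos hΔ1 hS₀pos.le hs1' hS₀4' hsΔ' hC₉ hC₄ hc₁ hf₉0 he₂0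
    he₉ hlog (by positivity) hδ he₂' hpow hn (by rw [hg]; exact hε') le_rfl hx1 hx2 hx3 hx4
  rw [← hCtot] at hbound
  calc |cubeClassSum (dWeight X τ m) q α a S₀ - swMainTerm X τ m q a S₀|
      ≤ lemma92Bound X τ m c₃ c₄ V Δ S₀ K₀ A₀ C₉ c₉ Cθ cθ c₁ c₂ C₄ C₀ := hmain
    _ ≤ Ctot * (V * Δ) := hbound
    _ = Ctot * V * Δ := by ring

/-- **Lemma 3.8 from Lemma 9.4**: the named fact `HeathBrown2001_lemma_3_8` follows from the prime number theorem with
Grössencharaktere (Lemma 9.4, in the form `GrossenCharPNT`) alone — through Lemma 8.1 and Lemma 9.1 (theorems of the tree,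
`HeathBrownCubicLemma81Holds`) and Lemma 9.2 (`HeathBrown2001_lemma_9_2_of_lemma94`).
[cite: HeathBrownActa2001, Lemma 3.8, Lemma 8.1, Lemmas 9.1–9.5] -/
theorem HeathBrown2001_lemma_3_8_of_lemma94
    (h94 : ∀ A : ℝ, 0 < A → ∃ c C z₀ : ℝ, 0 < c ∧ GrossenCharPNT A c C z₀) : HeathBrown2001_lemma_3_8 :=
  HeathBrown2001_lemma_3_8_of_lemma92 (HeathBrown2001_lemma_9_2_of_lemma94 h94)

end Literature.NumberTheory.Sieve.CubicSieve
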